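import Literature.NumberTheory.Sieve.FriedlanderIwaniecSpin
import Literature.NumberTheory.Sieve.LargeSieveCharacters
import Literature.NumberTheory.QuadraticFields.JacobiCharacterPrimitiveProofs
import Literature.NumberTheory.QuadraticFields.GaussianNormCount
import Mathlib.Algebra.BigOperators.Module
import Mathlib.NumberTheory.ArithmeticFunction.Moebius
import Mathlib.Data.Nat.Squarefree
import Mathlib.Analysis.SpecialFunctions.Trigonometric.Bounds
import Mathlib.Analysis.SpecialFunctions.Trigonometric.Arctan
import HarnessLib

/-!
# Friedlander–Iwaniec, *The polynomial `X² + Y⁴` captures its primes*, §22: linear forms in Jacobi–Kubota symbols (Proposition 22.1, disc form)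

Family `parity` (rung F-SPIN of the parity-ideate ladder; also on the path to parity.S17). Source:
J. Friedlander, H. Iwaniec, Ann. of Math. (2) 148 (1998), 945–1040 [FriedlanderIwaniecAnnals1998]
(= arXiv:math/9811185), §22 "Linear forms in Jacobi-Kubota symbols", (22.1)–(22.8), Proposition 22.1
(arXiv pp. 78–79): for the special linear forms `𝒦(N) = Σ^∧_{z ∈ 𝔅} ψ(z) [wz]` ((22.1); `∧` = `z`
primary, `𝔅` a polar box in the disc `|z|² ≤ N`, `w` a fixed primary number, `ψ(z) = χ(z) (z/|z|)^k`
a Hecke character (17.17) with `χ` a character to modulus `4d`), "PROPOSITION 22.1. Given `ψ` and `w`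
as above we have (22.3) `𝒦(N) ≪ d(|k|+1) |w| N^{3/4} log |w|N` … where the implied constant is
absolute. Proof. We use the Polyá-Vinogradov theorem (22.5) … By Lemma 20.1 we write (22.6)
`𝒦(N) = ε[w] Σ^∧ ψ(z)[z] ξ_w(z)` … `ξ_w(z) = ((r+ωs)/q)` … For given `r` we translate `s` by `ωr`
getting `|𝒦(N)| ≤ Σ_{|r|<√N, r odd} |Σ_{s ∈ I(r)} χ(…) (…)^k (s/(q|r|))|` … The inner sum satisfies
`≪ d(|k|+1) √(q|r|) log q|r|` by the Polyá-Vinogradov estimate (22.5) provided that [the modulus is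
non-degenerate]. Here the factor `d` is lost by splitting `s` into residue classes modulo `4d` which
is necessary to fix the values of `χ`, whereas the factor `|k|+1` is lost from an application of
partial summation which is needed to remove the sector character. … If it is a square we simply use
the trivial bound `2√N`. Summing these bounds over `r` we obtain (22.3)."

## What is proved (everything; no named facts)

* `primaryNormLE N` — the primary `z ∈ ℤ[i]` with `1 ≤ z z̄ ≤ N` (the disc of (22.1));
  `mem_primaryNormLE`.
* `abs_sum_Icc_jacobiSym_le_of_not_isSquare` — **Pólya–Vinogradov (22.5) for the Jacobi symbol of any
  odd modulus that is not a perfect square** (the imprimitive case, from the tree's primitive case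
  `LargeSieve.polyaVinogradov` by `m = e² m₀` and Möbius over `e`): `|Σ_{a ≤ n ≤ b} (n/m)| ≤ √m (1+log m)`.
* `norm_linearFormK_le` — **Proposition 22.1, (22.3), for the disc `|z|² ≤ N`**: an absolute `C` with
  `‖Σ_{z primary, 1 ≤ |z|² ≤ N} ψ(z)[wz]‖ ≤ C · d(|k|+1) · |w| · N^{3/4} · log(|w| N)` for every `d ≥ 1`,
  every character `χ` of `ℤ[i]/(4d)`, every `k ∈ ℤ`, every primary `w` and every `N ≥ 2`
  (`|w| = √(w w̄)`; `ψ = heckePsi d χ k`, `[·] = jacobiKubota` of the tree).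

Proof = the printed one, made explicit: (i) if `w` is not primitive every `[wz]` vanishes; (ii) for
`w` primary primitive, Lemma 20.1 (`jacobiKubota_mul`) and (19.2) (`exists_int_dirichletSym_eq`) give
`ψ(z)[wz] = ε(w,z) [w] i^{(r-1)/2} ψ(z) (s/|r|) ((r+ωs)/q)`, `z = r + is`; (iii) the translation
`s = t + ωr` turns `(s/|r|)((r+ωs)/q)` into `(ω/q)(t/(q|r|))`; (iv) for fixed `r`, `t` is split into
classes modulo `4d` (on each class `χ(z)` and the primarity condition are constant), and on a class
`t = b + 4d u` the weight `ε · (z/|z|)^k` has total variation `≤ 2 + π|k|` (the sign `ε` of Lemma 20.1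
changes at most once along the line, the angular character is `sign(r) e^{i k arctan(s/r)}`), so Abel
summation and Pólya–Vinogradov for `u ↦ ((b + 4du)/(q|r|))` give `≪ (|k|+1) √(q|r|) log(q|r|)` per
class — unless `q|r| = a² e` with `e ∣ 4d` (then `((b+4du)/(q|r|))` may be constant), which happens
for at most `τ(4d) √(q√N)` values of `r`, each costing the trivial bound `≤ 3√N`; (v) summing over
`|r| ≤ √N`. The degenerate condition printed as "`q|r|/(d, q|r|)` is not a square" is implemented as
"`q|r|` is not of the form `a² e`, `e ∣ 4d`" (which is what the argument uses).

Not here: the polar-box version of (22.3) (only the disc is needed for Proposition 23.2 and Theorem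
2^ψ), the starred form (22.4) (not needed: see `FriedlanderIwaniecPrimesEigenvalueLinearForms` for
Proposition 23.2 directly from (22.3)), the Burgess remark (22.8).

## References

* J. Friedlander, H. Iwaniec, Ann. of Math. (2) 148 (1998), 945–1040, §22, (22.1)–(22.8),
  Proposition 22.1; §19 (19.2); §20 Lemma 20.1. [FriedlanderIwaniecAnnals1998]

## Tree / Mathlib

Tree: `FriedlanderIwaniecPrimes.heckePsi`, `GaussQuot`, `toQuot` (`FriedlanderIwaniecSpin`,
`…CharacterDetection`, `norm_mulChar_apply_le_one`), `jacobiKubota`, `jacobiKubota_mul`, `kubotaEps`,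
`hilbertInfty`, `jacobiKubota_eq_zero_of_not_isPrimitive` (`…JacobiKubota`), `dirichletSym`,
`exists_int_dirichletSym_eq`, `not_natCast_dvd_of_isPrimitive`, `re_odd_of_isPrimary`
(`…DirichletSymbol`), `GaussianPrimary.IsPrimary`, `primaryNormEq`, `mem_primaryNormEq`,
`LargeSieve.polyaVinogradov`, `QuadraticFields.jacobiChar`, `isPrimitive_jacobiChar`. Mathlib:
`jacobiSym.*`, `Nat.sq_mul_squarefree`, `ArithmeticFunction.moebius_mul_coe_zeta`,
`Finset.sum_range_by_parts`, `Real.cos_arctan`, `Real.sin_arctan`, `Real.norm_exp_I_mul_ofReal_sub_one_le`,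
`Nat.factorization_gcd`.
-/

noncomputable section

open Finset Real
open scoped NumberTheorySymbols ArithmeticFunction.Moebius

namespace Literature.NumberTheory.Sieve.FriedlanderIwaniecPrimes

open Literature.NumberTheory.QuadraticFields Literature.NumberTheory.QuadraticFields.GaussianPrimary
open Literature.NumberTheory.LFunctions.GaussianInt (IsPrimitive)
open GaussianInt (toComplex toComplex_def')

/-! ### Intervals of integers -/

/-- A finite set of integers is an *interval* if it contains every integer between two of its
members. [folklore] -/
private def IsZInterval (S : Finset ℤ) : Prop :=
  ∀ ⦃x⦄, x ∈ S → ∀ ⦃y⦄, y ∈ S → ∀ ⦃z⦄, x ≤ z → z ≤ y → z ∈ S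

/-- `[a, b]` is an interval. [folklore] -/
private theorem isZInterval_Icc (a b : ℤ) : IsZInterval (Icc a b) := by
  intro x hx y hy z hxz hzy
  rw [mem_Icc] at hx hy ⊢
  exact ⟨hx.1.trans hxz, hzy.trans hy.2⟩

/-- The empty set is an interval. [folklore] -/
private theorem isZInterval_empty : IsZInterval (∅ : Finset ℤ) := fun x hx => by simp at hx

/-- A nonempty interval is `[min, max]`. [folklore] -/
private theorem IsZInterval.eq_Icc {S : Finset ℤ} (hS : IsZInterval S) (hne : S.Nonempty) :
    S = Icc (S.min' hne) (S.max' hne) := by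
  ext z
  rw [mem_Icc]
  constructor
  · intro hz; exact ⟨S.min'_le z hz, S.le_max' z hz⟩
  · rintro ⟨h1, h2⟩; exact hS (S.min'_mem hne) (S.max'_mem hne) h1 h2

/-- Every interval is some `[a, b]`. [folklore] -/
private theorem IsZInterval.exists_eq_Icc {S : Finset ℤ} (hS : IsZInterval S) : ∃ a b : ℤ, S = Icc a b := by
  rcases S.eq_empty_or_nonempty with h | hne
  · exact ⟨1, 0, by rw [h]; rfl⟩
  · exact ⟨_, _, hS.eq_Icc hne⟩

/-- A filter of an interval by a condition that is closed under betweenness is an interval.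
[folklore] -/
private theorem IsZInterval.filter {S : Finset ℤ} (hS : IsZInterval S) {p : ℤ → Prop} [DecidablePred p]
    (hp : ∀ ⦃x⦄, p x → ∀ ⦃y⦄, p y → ∀ ⦃z⦄, x ≤ z → z ≤ y → p z) : IsZInterval (S.filter p) := by
  intro x hx y hy z hxz hzy
  rw [mem_filter] at hx hy ⊢
  exact ⟨hS hx.1 hy.1 hxz hzy, hp hx.2 hy.2 hxz hzy⟩

/-- Prefixes of an interval are intervals. [folklore] -/
private theorem IsZInterval.filter_le {S : Finset ℤ} (hS : IsZInterval S) (c : ℤ) :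
    IsZInterval (S.filter (· ≤ c)) :=
  hS.filter fun _ _ _ hy _ _ hzy => hzy.trans hy

/-- Translates of an interval are intervals. [folklore] -/
private theorem IsZInterval.image_add {S : Finset ℤ} (hS : IsZInterval S) (c : ℤ) :
    IsZInterval (S.image (· + c)) := by
  intro x hx y hy z hxz hzy
  simp only [mem_image] at hx hy ⊢
  obtain ⟨x', hx', rfl⟩ := hx
  obtain ⟨y', hy', rfl⟩ := hy
  exact ⟨z - c, hS hx' hy' (by linarith) (by linarith), by ring⟩

/-- The set of `u` with `b + D u ∈ S` (`D > 0`), as a finite set. [folklore] -/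
private def apPreimage (S : Finset ℤ) (b D : ℤ) : Finset ℤ :=
  (S.image fun t => (t - b) / D).filter fun u => b + D * u ∈ S

/-- Membership in `apPreimage`. [folklore] -/
private theorem mem_apPreimage {S : Finset ℤ} {b D : ℤ} (hD : D ≠ 0) {u : ℤ} :
    u ∈ apPreimage S b D ↔ b + D * u ∈ S := by
  rw [apPreimage, mem_filter, mem_image]
  constructor
  · exact fun h => h.2
  · intro h
    refine ⟨⟨b + D * u, h, ?_⟩, h⟩
    rw [add_sub_cancel_left, mul_comm, Int.mul_ediv_cancel _ hD]

/-- The `u` with `b + D u` in an interval form an interval (`D > 0`). [folklore] -/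
private theorem IsZInterval.apPreimage {S : Finset ℤ} (hS : IsZInterval S) (b : ℤ) {D : ℤ} (hD : 0 < D) :
    IsZInterval (apPreimage S b D) := by
  intro x hx y hy z hxz hzy
  rw [mem_apPreimage hD.ne'] at hx hy ⊢
  exact hS hx hy (by nlinarith) (by nlinarith)

/-- Summing over the members of an interval-like set lying in a residue class `b (mod D)` is summing
over `apPreimage`. [folklore] -/
private theorem sum_filter_modEq_eq_sum_apPreimage {M : Type*} [AddCommMonoid M] (S : Finset ℤ) (b : ℤ)
    {D : ℤ} (hD : 0 < D) (F : ℤ → M) :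
    ∑ t ∈ S.filter (fun t => t % D = b % D), F t = ∑ u ∈ apPreimage S b D, F (b + D * u) := by
  rw [← sum_image (s := apPreimage S b D) (g := fun u => b + D * u) (f := F)]
  · refine sum_congr ?_ fun _ _ => rfl
    ext t
    rw [mem_filter, mem_image]
    constructor
    · rintro ⟨ht, hmod⟩
      refine ⟨(t - b) / D, ?_, ?_⟩
      · rw [mem_apPreimage hD.ne']
        have : b + D * ((t - b) / D) = t := by
          have hdvd : D ∣ t - b := Int.ModEq.dvd (hmod.symm) |>.elim fun c hc => ⟨c, by linarith⟩
          rw [Int.mul_ediv_cancel' hdvd]; ring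
        rwa [this]
      · have hdvd : D ∣ t - b := Int.ModEq.dvd (hmod.symm) |>.elim fun c hc => ⟨c, by linarith⟩
        rw [Int.mul_ediv_cancel' hdvd]; ring
    · rintro ⟨u, hu, rfl⟩
      rw [mem_apPreimage hD.ne'] at hu
      refine ⟨hu, ?_⟩
      rw [Int.add_mul_emod_self_left]
  · intro x _ y _ hxy
    have : D * x = D * y := by linarith
    exact mul_left_cancel₀ hD.ne' this

/-! ### Abel summation with bounded variation -/

/-- **Abel summation on `[A, A + n)`**: if all prefix sums of `a` are bounded by `P` in norm,
`‖h‖ ≤ H` on the range and `Σ_{j < n-1} ‖h(A+j+1) - h(A+j)‖ ≤ V`, then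
`‖Σ_{j<n} a(A+j) h(A+j)‖ ≤ P (H + V)`. [folklore] -/
private theorem norm_sum_range_mul_le {a h : ℤ → ℂ} (A : ℤ) (n : ℕ) {P H V : ℝ} (hP0 : 0 ≤ P)
    (hH0 : 0 ≤ H)
    (hP : ∀ m ≤ n, ‖∑ j ∈ range m, a (A + j)‖ ≤ P) (hH : ∀ j < n, ‖h (A + j)‖ ≤ H)
    (hV : ∑ j ∈ range (n - 1), ‖h (A + (j + 1 : ℕ)) - h (A + j)‖ ≤ V) :
    ‖∑ j ∈ range n, a (A + j) * h (A + j)‖ ≤ P * (H + V) := by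
  rcases Nat.eq_zero_or_pos n with rfl | hn
  · simp only [range_zero, sum_empty, norm_zero]
    have hV0 : 0 ≤ V := le_trans (by simp) hV
    positivity
  -- write the sum via summation by parts
  set f : ℕ → ℂ := fun j => h (A + j) with hf
  set g : ℕ → ℂ := fun j => a (A + j) with hg
  have hparts := Finset.sum_range_by_parts f g n
  have hcomm : ∑ j ∈ range n, a (A + j) * h (A + j) = ∑ j ∈ range n, f j • g j := by
    refine sum_congr rfl fun j _ => ?_
    simp only [hf, hg, smul_eq_mul]; ring
  rw [hcomm, hparts]
  have h1 : ‖f (n - 1) • ∑ i ∈ range n, g i‖ ≤ H * P := by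
    rw [norm_smul]
    exact mul_le_mul (hH (n - 1) (by omega)) (hP n le_rfl) (norm_nonneg _)
      (le_trans (norm_nonneg _) (hH (n - 1) (by omega)))
  have h2 : ‖∑ i ∈ range (n - 1), (f (i + 1) - f i) • ∑ j ∈ range (i + 1), g j‖ ≤ V * P := by
    calc ‖∑ i ∈ range (n - 1), (f (i + 1) - f i) • ∑ j ∈ range (i + 1), g j‖
        ≤ ∑ i ∈ range (n - 1), ‖(f (i + 1) - f i) • ∑ j ∈ range (i + 1), g j‖ := norm_sum_le _ _
      _ ≤ ∑ i ∈ range (n - 1), ‖h (A + (i + 1 : ℕ)) - h (A + i)‖ * P := by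
          refine sum_le_sum fun i hi => ?_
          rw [mem_range] at hi
          rw [norm_smul]
          exact mul_le_mul le_rfl (hP (i + 1) (by omega)) (norm_nonneg _) (norm_nonneg _)
      _ = (∑ i ∈ range (n - 1), ‖h (A + (i + 1 : ℕ)) - h (A + i)‖) * P := by rw [sum_mul]
      _ ≤ V * P := mul_le_mul_of_nonneg_right hV hP0
  calc ‖f (n - 1) • ∑ i ∈ range n, g i -
        ∑ i ∈ range (n - 1), (f (i + 1) - f i) • ∑ j ∈ range (i + 1), g j‖
      ≤ ‖f (n - 1) • ∑ i ∈ range n, g i‖ +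
        ‖∑ i ∈ range (n - 1), (f (i + 1) - f i) • ∑ j ∈ range (i + 1), g j‖ := norm_sub_le _ _
    _ ≤ H * P + V * P := add_le_add h1 h2
    _ = P * (H + V) := by ring

/-- Sums over an integer interval `[a, b]` as sums over `range`. [folklore] -/
private theorem sum_Icc_int_eq_sum_range {M : Type*} [AddCommMonoid M] (F : ℤ → M) (a b : ℤ) :
    ∑ u ∈ Icc a b, F u = ∑ j ∈ range (b + 1 - a).toNat, F (a + j) := by
  rw [Int.Icc_eq_finset_map, sum_map]
  refine sum_congr rfl fun j _ => ?_
  simp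

/-- **Abel summation with bounded variation over an interval of integers**: if every prefix sum of
`a` over `S` has norm `≤ P`, `‖h‖ ≤ H` on `S` and `Σ_{u, u+1 ∈ S} ‖h(u+1) - h(u)‖ ≤ V`, then
`‖Σ_{u ∈ S} a(u) h(u)‖ ≤ P (H + V)`. [folklore] -/
private theorem norm_sum_mul_le_of_isZInterval {S : Finset ℤ} (hS : IsZInterval S) {a h : ℤ → ℂ}
    {P H V : ℝ} (hP0 : 0 ≤ P) (hH0 : 0 ≤ H)
    (hP : ∀ c : ℤ, ‖∑ u ∈ S.filter (· ≤ c), a u‖ ≤ P) (hH : ∀ u ∈ S, ‖h u‖ ≤ H)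
    (hV : ∑ u ∈ S.filter (fun u => u + 1 ∈ S), ‖h (u + 1) - h u‖ ≤ V) :
    ‖∑ u ∈ S, a u * h u‖ ≤ P * (H + V) := by
  rcases S.eq_empty_or_nonempty with rfl | hne
  · have hV0 : 0 ≤ V := le_trans (by simp) hV
    simp only [sum_empty, norm_zero]; positivity
  set A := S.min' hne
  set B := S.max' hne
  have hSeq : S = Icc A B := hS.eq_Icc hne
  have hAB : A ≤ B := S.min'_le B (S.max'_mem hne)
  set n := (B + 1 - A).toNat with hn
  have hn' : (n : ℤ) = B + 1 - A := by rw [hn, Int.toNat_of_nonneg (by linarith)]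
  rw [hSeq, sum_Icc_int_eq_sum_range]
  refine norm_sum_range_mul_le A n hP0 hH0 ?_ ?_ ?_
  · intro m hm
    have := hP (A + m - 1)
    have hset : S.filter (· ≤ A + m - 1) = Icc A (A + m - 1) := by
      rw [hSeq]; ext u; simp only [mem_filter, mem_Icc]
      constructor
      · rintro ⟨⟨h1, -⟩, h3⟩; exact ⟨h1, h3⟩
      · rintro ⟨h1, h2⟩
        have : (m : ℤ) ≤ n := by exact_mod_cast hm
        exact ⟨⟨h1, by linarith⟩, h2⟩
    rw [hset, sum_Icc_int_eq_sum_range] at this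
    have hmm : (A + m - 1 + 1 - A).toNat = m := by
      rw [show A + (m : ℤ) - 1 + 1 - A = m by ring]; exact Int.toNat_natCast m
    rwa [hmm] at this
  · intro j hj
    refine hH _ ?_
    rw [hSeq, mem_Icc]
    have : (j : ℤ) < n := by exact_mod_cast hj
    constructor <;> linarith
  · have hset : S.filter (fun u => u + 1 ∈ S) = Icc A (B - 1) := by
      rw [hSeq]; ext u; simp only [mem_filter, mem_Icc]
      constructor
      · rintro ⟨⟨h1, -⟩, -, h4⟩; exact ⟨h1, by linarith⟩
      · rintro ⟨h1, h2⟩; exact ⟨⟨h1, by linarith⟩, by linarith, by linarith⟩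
    rw [hset, sum_Icc_int_eq_sum_range] at hV
    have hmm : (B - 1 + 1 - A).toNat = n - 1 := by
      have : (B - 1 + 1 - A) = (n : ℤ) - 1 := by rw [hn']; ring
      rw [this]
      have hn1 : 1 ≤ n := by
        have : (1 : ℤ) ≤ n := by rw [hn']; linarith
        exact_mod_cast this
      have : ((n : ℤ) - 1) = ((n - 1 : ℕ) : ℤ) := by push_cast [Nat.cast_sub hn1]; ring
      rw [this, Int.toNat_natCast]
    rw [hmm] at hV
    refine le_of_eq_of_le ?_ hV
    refine sum_congr rfl fun j _ => ?_
    congr 2; push_cast; ring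

/-! ### Pólya–Vinogradov over integer intervals -/

open Literature.NumberTheory.Sieve.LargeSieve (polyaVinogradov)

/-- **Pólya–Vinogradov on an arbitrary interval of integers**: for a primitive character `χ` modulo
`q ≥ 2` and integers `a, b`, `‖Σ_{n ∈ [a, b]} χ(n)‖ ≤ √q (1 + log q)`. (From the tree's version on
`ℕ` by periodicity.) [folklore] -/
private theorem norm_sum_Icc_le_polyaVinogradov_int {q : ℕ} (hq : 2 ≤ q) {χ : DirichletCharacter ℂ q}
    (hχ : χ.IsPrimitive) (a b : ℤ) :
    ‖∑ n ∈ Icc a b, χ (n : ZMod q)‖ ≤ Real.sqrt q * (1 + Real.log q) := by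
  have hq0 : (0 : ℤ) < q := by exact_mod_cast (by omega : 0 < q)
  rcases lt_or_ge b a with hba | hab
  · rw [Finset.Icc_eq_empty (not_le.mpr hba), sum_empty, norm_zero]
    have : 0 ≤ Real.log q := Real.log_nonneg (by exact_mod_cast (by omega : 1 ≤ q))
    positivity
  -- shift by a multiple of `q` into the positive integers
  set K : ℤ := |a| + 1 with hK
  have hK0 : 0 ≤ K := by positivity
  set A : ℤ := a + K * q - 1 with hA
  have hA0 : 0 ≤ A := by
    have : |a| * 1 ≤ |a| * (q : ℤ) := mul_le_mul_of_nonneg_left (by exact_mod_cast (by omega : 1 ≤ q))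
      (abs_nonneg a)
    have h2 : -|a| ≤ a := neg_abs_le a
    nlinarith
  set N : ℕ := (b + 1 - a).toNat with hN
  have hN' : (N : ℤ) = b + 1 - a := by rw [hN, Int.toNat_of_nonneg (by linarith)]
  have hPV := polyaVinogradov hq hχ A.toNat N
  -- identify the two sums
  have hsum : ∑ n ∈ Icc a b, χ (n : ZMod q) = ∑ n ∈ Ioc A.toNat (A.toNat + N), χ (n : ZMod q) := by
    rw [sum_Icc_int_eq_sum_range]
    have hIoc : Ioc A.toNat (A.toNat + N) = (range N).map (addLeftEmbedding (A.toNat + 1)) := by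
      ext n; simp only [mem_Ioc, mem_map, mem_range, addLeftEmbedding_apply]
      constructor
      · rintro ⟨h1, h2⟩; exact ⟨n - (A.toNat + 1), by omega, by omega⟩
      · rintro ⟨j, hj, rfl⟩; omega
    rw [hIoc, sum_map]
    refine sum_congr (by rw [hN]) fun j _ => ?_
    simp only [addLeftEmbedding_apply]
    -- `χ (a + j) = χ (A.toNat + 1 + j)` since they differ by `K q`
    have hcast : ((A.toNat + 1 + j : ℕ) : ZMod q) = ((a + j : ℤ) : ZMod q) := by
      have h1 : ((A.toNat + 1 + j : ℕ) : ℤ) = (a + j) + (K * q) := by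
        push_cast; rw [Int.toNat_of_nonneg hA0, hA]; ring
      have h2 : ((A.toNat + 1 + j : ℕ) : ZMod q) = (((A.toNat + 1 + j : ℕ) : ℤ) : ZMod q) := by
        push_cast; rfl
      rw [h2, h1]; push_cast
      rw [ZMod.natCast_self, mul_zero, add_zero]
    rw [hcast]
  rw [hsum]
  exact hPV

/-! ### Jacobi symbols: congruence in the top entry prime by prime -/

/-- The Jacobi symbol `(a / b)` depends only on `a` modulo the primes dividing `b`: if every prime
`p ∣ b` divides `a - a'` then `(a / b) = (a' / b)`. [folklore] -/
private theorem jacobiSym_eq_of_forall_prime_dvd_sub {a a' : ℤ} {b : ℕ}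
    (h : ∀ p : ℕ, p.Prime → p ∣ b → (p : ℤ) ∣ a - a') : J(a | b) = J(a' | b) := by
  unfold jacobiSym
  congr 1
  refine List.pmap_congr_left _ fun p hp h₁ h₂ => ?_
  have hpp : p.Prime := Nat.prime_of_mem_primeFactorsList hp
  haveI : Fact p.Prime := ⟨hpp⟩
  have hpb : p ∣ b := Nat.dvd_of_mem_primeFactorsList hp
  have hc : (a : ZMod p) = (a' : ZMod p) :=
    (ZMod.intCast_eq_intCast_iff_dvd_sub a a' p).mpr (dvd_sub_comm.mp (h p hpp hpb))
  simp only [legendreSym]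
  rw [hc]

/-! ### Möbius inversion for a coprimality condition -/

/-- `Σ_{f ∣ g} μ(f) = [g = 1]` (for `g = 0` both sides vanish). [folklore] -/
private theorem moebius_divisorSum_eq_ite (g : ℕ) :
    ∑ f ∈ g.divisors, (μ f : ℤ) = if g = 1 then 1 else 0 := by
  have h : (μ * ArithmeticFunction.zeta : ArithmeticFunction ℤ) g = (1 : ArithmeticFunction ℤ) g := by
    rw [ArithmeticFunction.moebius_mul_coe_zeta]
  rw [ArithmeticFunction.coe_mul_zeta_apply, ArithmeticFunction.one_apply] at h
  exact h

/-- **Möbius inversion of the condition `(n, e) = 1` inside a finite sum**: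
`Σ_{n ∈ S, (n,e)=1} F(n) = Σ_{f ∣ e} μ(f) Σ_{n ∈ S, f ∣ n} F(n)` (`e ≥ 1`). [folklore] -/
private theorem sum_filter_coprime_eq_sum_divisors_moebius {M : Type*} [AddCommGroup M] (S : Finset ℤ)
    {e : ℕ} (he : e ≠ 0) (F : ℤ → M) :
    ∑ n ∈ S.filter (fun n => Int.gcd n e = 1), F n =
      ∑ f ∈ e.divisors, (μ f : ℤ) • ∑ n ∈ S.filter (fun n => (f : ℤ) ∣ n), F n := by
  -- expand the indicator by Möbius
  have hind : ∀ n : ℤ, (if Int.gcd n e = 1 then (1 : ℤ) else 0) =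
      ∑ f ∈ e.divisors, if (f : ℤ) ∣ n then (μ f : ℤ) else 0 := by
    intro n
    rw [← moebius_divisorSum_eq_ite (Int.gcd n e), ← sum_filter]
    refine sum_congr ?_ fun _ _ => rfl
    ext f
    simp only [Nat.mem_divisors, mem_filter, ne_eq]
    constructor
    · rintro ⟨hf, -⟩
      have h1 : (f : ℤ) ∣ (Int.gcd n e : ℤ) := Int.natCast_dvd_natCast.mpr hf
      refine ⟨⟨?_, he⟩, h1.trans (Int.gcd_dvd_left _ _)⟩
      exact Int.natCast_dvd_natCast.mp (h1.trans (Int.gcd_dvd_right _ _))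
    · rintro ⟨⟨hfe, -⟩, hfn⟩
      refine ⟨?_, ?_⟩
      · exact Int.natCast_dvd_natCast.mp (Int.dvd_coe_gcd hfn (Int.natCast_dvd_natCast.mpr hfe))
      · intro h0
        exact he (by have := (Int.gcd_eq_zero_iff.mp h0).2; exact_mod_cast this)
  calc ∑ n ∈ S.filter (fun n => Int.gcd n e = 1), F n
      = ∑ n ∈ S, (if Int.gcd n e = 1 then (1 : ℤ) else 0) • F n := by
        rw [sum_filter]; refine sum_congr rfl fun n _ => ?_; split_ifs <;> simp
    _ = ∑ n ∈ S, ∑ f ∈ e.divisors, (if (f : ℤ) ∣ n then (μ f : ℤ) else 0) • F n := by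
        refine sum_congr rfl fun n _ => ?_; rw [hind n, sum_smul]
    _ = ∑ f ∈ e.divisors, ∑ n ∈ S, (if (f : ℤ) ∣ n then (μ f : ℤ) else 0) • F n := sum_comm
    _ = ∑ f ∈ e.divisors, (μ f : ℤ) • ∑ n ∈ S.filter (fun n => (f : ℤ) ∣ n), F n := by
        refine sum_congr rfl fun f _ => ?_
        rw [sum_filter, smul_sum]
        refine sum_congr rfl fun n _ => ?_
        split_ifs <;> simp

/-! ### Pólya–Vinogradov for Jacobi symbols of non-square modulus -/

open Literature.NumberTheory.QuadraticFields (jacobiChar jacobiChar_intCast isPrimitive_jacobiChar)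

/-- `(n / e²) = [ (n, e) = 1 ]`. [folklore] -/
private theorem jacobiSym_sq_right (n : ℤ) {e : ℕ} (he : e ≠ 0) :
    J(n | e ^ 2) = if Int.gcd n e = 1 then 1 else 0 := by
  rw [sq, jacobiSym.mul_right' n he he, ← sq]
  split_ifs with h
  · exact jacobiSym.sq_one h
  · haveI : NeZero e := ⟨he⟩
    rw [jacobiSym.eq_zero_iff_not_coprime.mpr h]; ring

/-- Pólya–Vinogradov for the primitive quadratic character of odd squarefree modulus `m₀ ≥ 2` over
an interval of integers, in `ℝ`. [folklore] -/
private theorem abs_sum_jacobiSym_le_of_squarefree {m₀ : ℕ} (hodd : Odd m₀) (hsf : Squarefree m₀)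
    (hm : 2 ≤ m₀) {S : Finset ℤ} (hS : IsZInterval S) :
    |((∑ n ∈ S, J(n | m₀) : ℤ) : ℝ)| ≤ Real.sqrt m₀ * (1 + Real.log m₀) := by
  obtain ⟨a, b, rfl⟩ := hS.exists_eq_Icc
  haveI : NeZero m₀ := ⟨by omega⟩
  have h := norm_sum_Icc_le_polyaVinogradov_int hm (isPrimitive_jacobiChar hodd hsf) a b
  have hcast : ∑ n ∈ Icc a b, jacobiChar m₀ (n : ZMod m₀) = (((∑ n ∈ Icc a b, J(n | m₀) : ℤ) : ℝ) : ℂ) := by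
    push_cast
    exact sum_congr rfl fun n _ => jacobiChar_intCast n
  rw [hcast, Complex.norm_real, Real.norm_eq_abs] at h
  exact h

/-- **Pólya–Vinogradov for the Jacobi symbol of an odd modulus that is not a perfect square**
(possibly imprimitive): `|Σ_{n ∈ S} (n / m)| ≤ √m (1 + log m)` for every interval `S` of integers
(absolute constant; Friedlander–Iwaniec (22.5) "for any nontrivial Dirichlet character"). Proof:
`m = e² m₀` with `m₀ > 1` squarefree, `(n/m) = (n/m₀)[(n,e)=1]`, Möbius over `f ∣ e`, and
`τ(e) √m₀ ≤ e √m₀ = √m`. [cite: FriedlanderIwaniecAnnals1998, (22.5)] -/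
private theorem abs_sum_jacobiSym_le_of_not_isSquare {m : ℕ} (hodd : Odd m) (hsq : ¬ IsSquare m)
    {S : Finset ℤ} (hS : IsZInterval S) :
    |((∑ n ∈ S, J(n | m) : ℤ) : ℝ)| ≤ Real.sqrt m * (1 + Real.log m) := by
  obtain ⟨m₀, e, hem, hm₀⟩ := Nat.sq_mul_squarefree m
  have hm0 : m ≠ 0 := by rintro rfl; exact hsq ⟨0, rfl⟩
  have he0 : e ≠ 0 := by rintro rfl; simp at hem; exact hm0 hem.symm
  have hm₀0 : m₀ ≠ 0 := by rintro rfl; simp at hem; exact hm0 hem.symm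
  have hm₀1 : m₀ ≠ 1 := by rintro rfl; rw [mul_one] at hem; exact hsq ⟨e, by rw [← hem, sq]⟩
  have hm₀2 : 2 ≤ m₀ := by omega
  have hm₀odd : Odd m₀ := hodd.of_dvd_nat ⟨e ^ 2, by rw [← hem, mul_comm]⟩
  have hm₀le : (m₀ : ℝ) ≤ m := by
    have : m₀ ≤ m := Nat.le_of_dvd (Nat.pos_of_ne_zero hm0) ⟨e ^ 2, by rw [← hem, mul_comm]⟩
    exact_mod_cast this
  -- `(n/m) = [(n,e)=1] (n/m₀)`
  have hfac : ∀ n : ℤ, J(n | m) = (if Int.gcd n e = 1 then 1 else 0) * J(n | m₀) := by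
    intro n
    rw [← hem, jacobiSym.mul_right' n (pow_ne_zero 2 he0) hm₀0, jacobiSym_sq_right n he0]
  have hsum : (∑ n ∈ S, J(n | m)) = ∑ n ∈ S.filter (fun n => Int.gcd n e = 1), J(n | m₀) := by
    rw [sum_filter]
    refine sum_congr rfl fun n _ => ?_
    rw [hfac n]; split_ifs <;> simp
  rw [hsum, sum_filter_coprime_eq_sum_divisors_moebius S he0]
  -- each inner sum: multiples of `f` in `S`
  have hinner : ∀ f ∈ e.divisors,
      |((∑ n ∈ S.filter (fun n => (f : ℤ) ∣ n), J(n | m₀) : ℤ) : ℝ)| ≤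
        Real.sqrt m₀ * (1 + Real.log m₀) := by
    intro f hf
    have hf0 : f ≠ 0 := Nat.pos_of_mem_divisors hf |>.ne'
    have hf0' : (0 : ℤ) < f := by exact_mod_cast Nat.pos_of_ne_zero hf0
    have hset : S.filter (fun n => (f : ℤ) ∣ n) = S.filter (fun n => n % (f : ℤ) = 0 % (f : ℤ)) := by
      refine filter_congr fun n _ => ?_
      rw [Int.zero_emod]
      exact Int.dvd_iff_emod_eq_zero
    rw [hset, sum_filter_modEq_eq_sum_apPreimage S 0 hf0']
    simp only [zero_add]
    have hmul : ∑ u ∈ apPreimage S 0 f, J((f : ℤ) * u | m₀) = J((f : ℤ) | m₀) * ∑ u ∈ apPreimage S 0 f, J(u | m₀) := by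
      rw [mul_sum]; exact sum_congr rfl fun u _ => jacobiSym.mul_left _ _ _
    rw [hmul]
    push_cast
    rw [abs_mul]
    have hJ : |((J((f : ℤ) | m₀) : ℤ) : ℝ)| ≤ 1 := by
      rcases jacobiSym.trichotomy (f : ℤ) m₀ with h | h | h <;> rw [h] <;> simp
    have hI := abs_sum_jacobiSym_le_of_squarefree hm₀odd hm₀ hm₀2 (hS.apPreimage 0 hf0')
    push_cast at hI
    calc |((J((f : ℤ) | m₀) : ℤ) : ℝ)| * |∑ u ∈ apPreimage S 0 f, ((J(u | m₀) : ℤ) : ℝ)|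
        ≤ 1 * (Real.sqrt m₀ * (1 + Real.log m₀)) :=
          mul_le_mul hJ hI (abs_nonneg _) zero_le_one
      _ = Real.sqrt m₀ * (1 + Real.log m₀) := one_mul _
  -- sum over the divisors of `e`
  have hlog₀ : 0 ≤ Real.log m₀ := Real.log_nonneg (by exact_mod_cast (by omega : 1 ≤ m₀))
  have hlogm : 0 ≤ Real.log m := Real.log_nonneg (by exact_mod_cast Nat.pos_of_ne_zero hm0)
  simp only [smul_eq_mul]
  push_cast
  calc |∑ f ∈ e.divisors, ((μ f : ℤ) : ℝ) * ∑ n ∈ S.filter (fun n => (f : ℤ) ∣ n), ((J(n | m₀) : ℤ) : ℝ)|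
      ≤ ∑ f ∈ e.divisors, |((μ f : ℤ) : ℝ) * ∑ n ∈ S.filter (fun n => (f : ℤ) ∣ n), ((J(n | m₀) : ℤ) : ℝ)| :=
        abs_sum_le_sum_abs _ _
    _ ≤ ∑ f ∈ e.divisors, Real.sqrt m₀ * (1 + Real.log m₀) := by
        refine sum_le_sum fun f hf => ?_
        rw [abs_mul]
        have hμ : |((μ f : ℤ) : ℝ)| ≤ 1 := by
          have := ArithmeticFunction.abs_moebius_le_one (n := f)
          exact_mod_cast this
        have hI := hinner f hf
        push_cast at hI
        calc |((μ f : ℤ) : ℝ)| * |∑ n ∈ S.filter (fun n => (f : ℤ) ∣ n), ((J(n | m₀) : ℤ) : ℝ)|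
            ≤ 1 * (Real.sqrt m₀ * (1 + Real.log m₀)) :=
              mul_le_mul hμ hI (abs_nonneg _) zero_le_one
          _ = _ := one_mul _
    _ = (e.divisors.card : ℝ) * (Real.sqrt m₀ * (1 + Real.log m₀)) := by
        rw [sum_const, nsmul_eq_mul]
    _ ≤ (e : ℝ) * (Real.sqrt m₀ * (1 + Real.log m)) := by
        have h1 : (e.divisors.card : ℝ) ≤ e := by exact_mod_cast Nat.card_divisors_le_self e
        have h2 : Real.log (m₀ : ℝ) ≤ Real.log m :=
          Real.log_le_log (by exact_mod_cast Nat.pos_of_ne_zero hm₀0) hm₀le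
        have h3 : 0 ≤ Real.sqrt (m₀ : ℝ) * (1 + Real.log m₀) := by positivity
        calc (e.divisors.card : ℝ) * (Real.sqrt m₀ * (1 + Real.log m₀))
            ≤ e * (Real.sqrt m₀ * (1 + Real.log m₀)) := mul_le_mul_of_nonneg_right h1 h3
          _ ≤ e * (Real.sqrt m₀ * (1 + Real.log m)) := by
              refine mul_le_mul_of_nonneg_left ?_ (by positivity)
              exact mul_le_mul_of_nonneg_left (by linarith) (Real.sqrt_nonneg _)
    _ = Real.sqrt m * (1 + Real.log m) := by
        have : (e : ℝ) * Real.sqrt m₀ = Real.sqrt m := by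
          rw [← hem]; push_cast
          rw [Real.sqrt_mul' _ (by positivity), Real.sqrt_sq (by positivity)]
        rw [← mul_assoc, this]

/-! ### Arithmetic progressions: the square class of the difference -/

/-- `Q` is in the *square class* of `D`: `Q = a² e` with `e ∣ D`. For such `Q` the Jacobi symbol
`((b + D u)/Q)` can be constant in `u` (no cancellation); Friedlander–Iwaniec: "If it is a square we
simply use the trivial bound". [cite: FriedlanderIwaniecAnnals1998, §22 (proof of (22.3))] -/
private def APSquareClass (Q D : ℕ) : Prop := ∃ a e : ℕ, e ∣ D ∧ Q = a ^ 2 * e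

/-- The part of `Q` supported on the primes of `D`: `gcd(Q, D^Q)`. [folklore] -/
private def dPart (Q D : ℕ) : ℕ := Nat.gcd Q (D ^ Q)

/-- `dPart Q D ∣ Q`. [folklore] -/
private theorem dPart_dvd (Q D : ℕ) : dPart Q D ∣ Q := Nat.gcd_dvd_left _ _

/-- Every prime factor of `dPart Q D` divides `D`. [folklore] -/
private theorem dvd_of_prime_dvd_dPart {Q D p : ℕ} (hp : p.Prime) (h : p ∣ dPart Q D) : p ∣ D :=
  hp.dvd_of_dvd_pow (h.trans (Nat.gcd_dvd_right _ _))

/-- `Q / dPart Q D` is coprime to `D` (`Q ≠ 0`). [folklore] -/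
private theorem coprime_div_dPart {Q D : ℕ} (hQ : Q ≠ 0) (hD : D ≠ 0) : Nat.Coprime (Q / dPart Q D) D := by
  refine Nat.coprime_of_dvd fun p hp' hpQ hpD => ?_
  have hpow : D ^ Q ≠ 0 := pow_ne_zero _ hD
  have hd0 : dPart Q D ≠ 0 := Nat.pos_of_ne_zero (Nat.gcd_pos_of_pos_left _ (Nat.pos_of_ne_zero hQ)).ne' |>.ne'
  -- valuations
  have hv1 : (dPart Q D).factorization p = min (Q.factorization p) (Q * D.factorization p) := by
    rw [dPart, Nat.factorization_gcd hQ hpow, Finsupp.inf_apply, Nat.factorization_pow]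
    simp
  have hvQ : Q.factorization p < Q := Nat.factorization_lt p hQ
  have hvD : 1 ≤ D.factorization p := (hp'.dvd_iff_one_le_factorization hD).mp hpD
  have hmin : min (Q.factorization p) (Q * D.factorization p) = Q.factorization p := by
    apply min_eq_left
    calc Q.factorization p ≤ Q := hvQ.le
      _ = Q * 1 := (mul_one Q).symm
      _ ≤ Q * D.factorization p := Nat.mul_le_mul_left Q hvD
  have hv2 : (Q / dPart Q D).factorization p = 0 := by
    rw [Nat.factorization_div (dPart_dvd Q D), Finsupp.tsub_apply, hv1, hmin, Nat.sub_self]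
  have hdiv0 : Q / dPart Q D ≠ 0 := by
    intro h0
    rcases Nat.div_eq_zero_iff.mp h0 with h | h
    · exact hd0 h
    · exact absurd (Nat.le_of_dvd (Nat.pos_of_ne_zero hQ) (dPart_dvd Q D)) (not_le.mpr h)
  have := (hp'.dvd_iff_one_le_factorization hdiv0).mp hpQ
  omega

/-- `Q = dPart · (Q / dPart)`. [folklore] -/
private theorem dPart_mul_div (Q D : ℕ) : dPart Q D * (Q / dPart Q D) = Q :=
  Nat.mul_div_cancel' (dPart_dvd Q D)

/-- A squarefree number all of whose prime factors divide `D` divides `D`. [folklore] -/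
private theorem dvd_of_squarefree_of_forall_prime_dvd {e D : ℕ} (he : Squarefree e)
    (h : ∀ p : ℕ, p.Prime → p ∣ e → p ∣ D) : e ∣ D := by
  rw [← Nat.prod_primeFactors_of_squarefree he]
  exact Finset.prod_primes_dvd D (fun p hp => (Nat.prime_of_mem_primeFactors hp).prime)
    fun p hp => h p (Nat.prime_of_mem_primeFactors hp) (Nat.dvd_of_mem_primeFactors hp)

/-- If `Q / dPart Q D` is a perfect square then `Q` is in the square class of `D`. [folklore] -/
private theorem apSquareClass_of_isSquare_div {Q D : ℕ} (h : IsSquare (Q / dPart Q D)) : APSquareClass Q D := by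
  obtain ⟨t, ht⟩ := h
  obtain ⟨e, c, hce, hesq⟩ := Nat.sq_mul_squarefree (dPart Q D)
  have heD : e ∣ D := dvd_of_squarefree_of_forall_prime_dvd hesq fun p hp hpe =>
    dvd_of_prime_dvd_dPart hp (hpe.trans ⟨c ^ 2, by rw [← hce, mul_comm]⟩)
  refine ⟨c * t, e, heD, ?_⟩
  calc Q = dPart Q D * (Q / dPart Q D) := (dPart_mul_div Q D).symm
    _ = c ^ 2 * e * (t * t) := by rw [hce, ht]
    _ = (c * t) ^ 2 * e := by ring

/-- **Pólya–Vinogradov along an arithmetic progression**: for `Q` odd not in the square class of `D`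
(`D ≥ 1`), any `b` and any interval `S` of integers,
`|Σ_{u ∈ S} ((b + D u)/Q)| ≤ √Q (1 + log Q)`. (Split `Q = Q₁ Q₂` with `Q₁ = dPart Q D`: `((b+Du)/Q₁)`
is constant, and `((b+Du)/Q₂) = (D/Q₂)((D⁻¹b + u)/Q₂)` is a sum over consecutive integers of a
non-principal Jacobi symbol.) [cite: FriedlanderIwaniecAnnals1998, §22 (proof of (22.3))] -/
private theorem abs_sum_jacobiSym_linear_le {Q D : ℕ} (hodd : Odd Q) (hD : 0 < D) (hnd : ¬ APSquareClass Q D)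
    (b : ℤ) {S : Finset ℤ} (hS : IsZInterval S) :
    |((∑ u ∈ S, J(b + D * u | Q) : ℤ) : ℝ)| ≤ Real.sqrt Q * (1 + Real.log Q) := by
  have hQ0 : Q ≠ 0 := by rintro rfl; exact (Nat.not_odd_iff_even.mpr (by decide) hodd)
  set Q₁ := dPart Q D with hQ₁
  set Q₂ := Q / dPart Q D with hQ₂
  have hQ12 : Q₁ * Q₂ = Q := dPart_mul_div Q D
  have hQ₁0 : Q₁ ≠ 0 := fun h => hQ0 (by rw [← hQ12, h, zero_mul])
  have hQ₂0 : Q₂ ≠ 0 := fun h => hQ0 (by rw [← hQ12, h, mul_zero])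
  have hsq : ¬ IsSquare Q₂ := fun h => hnd (apSquareClass_of_isSquare_div h)
  have hQ₂1 : Q₂ ≠ 1 := fun h => hsq ⟨1, by rw [h]⟩
  have hQ₂2 : 1 < Q₂ := Nat.one_lt_iff_ne_zero_and_ne_one.mpr ⟨hQ₂0, hQ₂1⟩
  have hQ₂odd : Odd Q₂ := hodd.of_dvd_nat ⟨Q₁, by rw [← hQ12, mul_comm]⟩
  have hcop : Nat.Coprime Q₂ D := coprime_div_dPart hQ0 hD.ne'
  -- an inverse of `D` modulo `Q₂`
  obtain ⟨Dinv, -, hDinv⟩ := Nat.exists_mul_mod_eq_one_of_coprime hcop.symm hQ₂2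
  -- factor the symbol
  have hfac : ∀ u : ℤ, J(b + D * u | Q) = J(b | Q₁) * (J((D : ℤ) | Q₂) * J((Dinv : ℤ) * b + u | Q₂)) := by
    intro u
    rw [← hQ12, jacobiSym.mul_right' _ hQ₁0 hQ₂0]
    congr 1
    · refine jacobiSym_eq_of_forall_prime_dvd_sub fun p hp hpQ₁ => ?_
      rw [add_sub_cancel_left]
      exact (Int.natCast_dvd_natCast.mpr (dvd_of_prime_dvd_dPart hp hpQ₁)).mul_right u
    · rw [← jacobiSym.mul_left]
      refine jacobiSym.mod_left' ?_
      -- `b + D u ≡ D (Dinv b + u) (mod Q₂)` since `D Dinv ≡ 1`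
      have hDD : (D : ℤ) * Dinv ≡ 1 [ZMOD (Q₂ : ℤ)] := by
        have : ((D * Dinv % Q₂ : ℕ) : ℤ) = ((1 : ℕ) : ℤ) := by rw [hDinv]
        push_cast at this
        rw [Int.ModEq, this, Int.emod_eq_of_lt (by norm_num) (by exact_mod_cast hQ₂2)]
      have hcong : (D : ℤ) * (Dinv * b + u) ≡ b + D * u [ZMOD (Q₂ : ℤ)] := by
        have h4 := (hDD.mul_right b).add_right ((D : ℤ) * u)
        calc (D : ℤ) * (Dinv * b + u) = D * Dinv * b + D * u := by ring
          _ ≡ 1 * b + D * u [ZMOD (Q₂ : ℤ)] := h4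
          _ = b + D * u := by ring
      exact hcong.symm
  -- the sum
  have hsum : (∑ u ∈ S, J(b + D * u | Q)) =
      J(b | Q₁) * J((D : ℤ) | Q₂) * ∑ n ∈ S.image (· + (Dinv : ℤ) * b), J(n | Q₂) := by
    rw [sum_image (fun x _ y _ h => by simpa using h), mul_sum]
    refine sum_congr rfl fun u _ => ?_
    rw [hfac u, add_comm u]; ring
  rw [hsum]
  push_cast
  rw [abs_mul, abs_mul]
  have hJ1 : |((J(b | Q₁) : ℤ) : ℝ)| ≤ 1 := by
    rcases jacobiSym.trichotomy b Q₁ with h | h | h <;> rw [h] <;> simp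
  have hJ2 : |((J((D : ℤ) | Q₂) : ℤ) : ℝ)| ≤ 1 := by
    rcases jacobiSym.trichotomy (D : ℤ) Q₂ with h | h | h <;> rw [h] <;> simp
  have hI := abs_sum_jacobiSym_le_of_not_isSquare hQ₂odd hsq (hS.image_add ((Dinv : ℤ) * b))
  push_cast at hI
  have hQ₂le : (Q₂ : ℝ) ≤ Q := by
    have : Q₂ ≤ Q := Nat.div_le_self _ _
    exact_mod_cast this
  have hlog2 : 0 ≤ Real.log (Q₂ : ℝ) := Real.log_nonneg (by exact_mod_cast hQ₂2.le)
  calc |((J(b | Q₁) : ℤ) : ℝ)| * |((J((D : ℤ) | Q₂) : ℤ) : ℝ)| *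
        |∑ n ∈ S.image (· + (Dinv : ℤ) * b), ((J(n | Q₂) : ℤ) : ℝ)|
      ≤ 1 * 1 * (Real.sqrt Q₂ * (1 + Real.log Q₂)) := by
        refine mul_le_mul (mul_le_mul hJ1 hJ2 (abs_nonneg _) zero_le_one) hI (abs_nonneg _)
          (by norm_num)
    _ = Real.sqrt Q₂ * (1 + Real.log Q₂) := by ring
    _ ≤ Real.sqrt Q * (1 + Real.log Q) := by
        have h1 : Real.sqrt (Q₂ : ℝ) ≤ Real.sqrt Q := Real.sqrt_le_sqrt hQ₂le
        have h2 : Real.log (Q₂ : ℝ) ≤ Real.log Q :=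
          Real.log_le_log (by exact_mod_cast (by omega : 0 < Q₂)) hQ₂le
        exact mul_le_mul h1 (by linarith) (by positivity) (Real.sqrt_nonneg _)

/-! ### Counting the degenerate moduli `q r` -/

/-- **The degenerate `r` are few**: for `q, D ≥ 1`, the number of `r ∈ [1, R]` with `q r` in the
square class of `D` is at most `τ(D) · ⌊√(qR)⌋` (for each `e ∣ D`, `r ↦ a` with `q r = a² e` is
injective into `[1, √(qR)]`). [folklore] -/
private theorem card_filter_apSquareClass_mul_le {q D : ℕ} (hq : 0 < q) (hD : 0 < D) (R : ℕ)
    [DecidablePred fun r : ℕ => APSquareClass (q * r) D] :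
    ((Icc 1 R).filter fun r => APSquareClass (q * r) D).card ≤ D.divisors.card * Nat.sqrt (q * R) := by
  classical
  -- cover by the pieces `e ∣ D`
  have hcover : ((Icc 1 R).filter fun r => APSquareClass (q * r) D) ⊆
      D.divisors.biUnion fun e => (Icc 1 R).filter fun r => ∃ a : ℕ, q * r = a ^ 2 * e := by
    intro r hr
    rw [mem_filter] at hr
    obtain ⟨a, e, heD, hqr⟩ := hr.2
    rw [mem_biUnion]
    exact ⟨e, Nat.mem_divisors.mpr ⟨heD, hD.ne'⟩, mem_filter.mpr ⟨hr.1, a, hqr⟩⟩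
  refine (card_le_card hcover).trans ((card_biUnion_le).trans ?_)
  have hpiece : ∀ e ∈ D.divisors,
      ((Icc 1 R).filter fun r => ∃ a : ℕ, q * r = a ^ 2 * e).card ≤ Nat.sqrt (q * R) := by
    intro e he
    have he0 : e ≠ 0 := (Nat.pos_of_mem_divisors he).ne'
    calc ((Icc 1 R).filter fun r => ∃ a : ℕ, q * r = a ^ 2 * e).card
        ≤ (Icc 1 (Nat.sqrt (q * R))).card := by
          refine card_le_card_of_injOn (fun r => Nat.sqrt (q * r / e)) ?_ ?_
          · intro r hr
            rw [mem_coe, mem_filter, mem_Icc] at hr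
            obtain ⟨⟨hr1, hrR⟩, a, ha⟩ := hr
            have hdiv : q * r / e = a ^ 2 := by
              rw [ha, Nat.mul_div_cancel _ (Nat.pos_of_ne_zero he0)]
            rw [mem_coe, mem_Icc]
            simp only [hdiv, Nat.sqrt_eq' a]
            constructor
            · rcases Nat.eq_zero_or_pos a with rfl | ha0
              · exfalso
                have : q * r = 0 := by rw [ha]; ring
                rcases Nat.mul_eq_zero.mp this with h | h <;> omega
              · exact ha0
            · rw [Nat.le_sqrt, ← sq]
              calc a ^ 2 ≤ a ^ 2 * e := Nat.le_mul_of_pos_right _ (Nat.pos_of_ne_zero he0)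
                _ = q * r := ha.symm
                _ ≤ q * R := Nat.mul_le_mul_left q hrR
          · intro r hr r' hr' h
            rw [mem_coe, mem_filter] at hr hr'
            obtain ⟨a, ha⟩ := hr.2
            obtain ⟨a', ha'⟩ := hr'.2
            simp only at h
            rw [ha, ha', Nat.mul_div_cancel _ (Nat.pos_of_ne_zero he0),
              Nat.mul_div_cancel _ (Nat.pos_of_ne_zero he0), Nat.sqrt_eq' a, Nat.sqrt_eq' a'] at h
            subst h
            exact Nat.eq_of_mul_eq_mul_left hq (ha.trans ha'.symm)
      _ = Nat.sqrt (q * R) := by simp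
  calc ∑ e ∈ D.divisors, ((Icc 1 R).filter fun r => ∃ a : ℕ, q * r = a ^ 2 * e).card
      ≤ ∑ e ∈ D.divisors, Nat.sqrt (q * R) := sum_le_sum hpiece
    _ = D.divisors.card * Nat.sqrt (q * R) := by rw [sum_const, smul_eq_mul]


/-! ### The disc of primary numbers `1 ≤ z z̄ ≤ N` and its coordinates -/

/-- The primary Gaussian integers `z` with `1 ≤ z z̄ ≤ N`: the range of summation `∧, |z|² ≤ N` of
(22.1) (disc case) and (23.9). [cite: FriedlanderIwaniecAnnals1998, (22.1)] -/
def primaryNormLE (N : ℕ) : Finset GaussianInt := (Icc 1 N).biUnion primaryNormEq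

/-- Membership in `primaryNormLE`. [cite: FriedlanderIwaniecAnnals1998, (22.1)] -/
theorem mem_primaryNormLE {N : ℕ} {z : GaussianInt} :
    z ∈ primaryNormLE N ↔ IsPrimary z ∧ 1 ≤ z.norm ∧ z.norm ≤ N := by
  rw [primaryNormLE, mem_biUnion]
  constructor
  · rintro ⟨n, hn, hz⟩
    rw [mem_Icc] at hn
    rw [mem_primaryNormEq] at hz
    refine ⟨hz.2, ?_, ?_⟩
    · rw [hz.1]; exact_mod_cast hn.1
    · rw [hz.1]; exact_mod_cast hn.2
  · rintro ⟨hp, h1, hN⟩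
    have h0 : 0 ≤ z.norm := by linarith
    refine ⟨z.norm.toNat, ?_, ?_⟩
    · rw [mem_Icc]
      have : (z.norm.toNat : ℤ) = z.norm := Int.toNat_of_nonneg h0
      constructor
      · have : (1 : ℤ) ≤ z.norm.toNat := by rw [this]; exact h1
        exact_mod_cast this
      · have : (z.norm.toNat : ℤ) ≤ N := by rw [this]; exact hN
        exact_mod_cast this
    · rw [mem_primaryNormEq]; exact ⟨by rw [Int.toNat_of_nonneg h0], hp⟩

/-- Primarity in coordinates: `r` odd and `4 ∣ r + s - 1`. [folklore] -/
private theorem isPrimary_iff_odd_and_dvd (z : GaussianInt) :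
    IsPrimary z ↔ Odd z.re ∧ (4 : ℤ) ∣ z.re + z.im - 1 := by
  unfold IsPrimary
  rw [Int.odd_iff, Int.dvd_iff_emod_eq_zero]
  omega

/-- `N(r + is) = r² + s²`. [folklore] -/
private theorem norm_mk (r s : ℤ) : (⟨r, s⟩ : GaussianInt).norm = r ^ 2 + s ^ 2 := by
  rw [Zsqrtd.norm_def]; ring

/-- `r² ≤ N ⇒ |r| ≤ ⌊√N⌋`. [folklore] -/
private theorem natAbs_le_sqrt {r : ℤ} {N : ℕ} (h : r ^ 2 ≤ N) : r.natAbs ≤ Nat.sqrt N := by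
  rw [Nat.le_sqrt']
  have : ((r.natAbs ^ 2 : ℕ) : ℤ) ≤ N := by push_cast; rw [sq_abs]; exact h
  exact_mod_cast this

/-- The `s`-fibre of the coordinates of `primaryNormLE N` over `r`. [folklore] -/
private def sFiber (N : ℕ) (r : ℤ) : Finset ℤ :=
  (Icc (-(Nat.sqrt N : ℤ)) (Nat.sqrt N : ℤ)).filter
    fun s => Odd r ∧ (4 : ℤ) ∣ r + s - 1 ∧ r ^ 2 + s ^ 2 ≤ N

/-- The `r`-range. [folklore] -/
private def rRange (N : ℕ) : Finset ℤ := Icc (-(Nat.sqrt N : ℤ)) (Nat.sqrt N : ℤ)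

/-- Membership in `sFiber`. [folklore] -/
private theorem mem_sFiber {N : ℕ} {r s : ℤ} :
    s ∈ sFiber N r ↔ (-(Nat.sqrt N : ℤ) ≤ s ∧ s ≤ (Nat.sqrt N : ℤ)) ∧ Odd r ∧ (4 : ℤ) ∣ r + s - 1 ∧
      r ^ 2 + s ^ 2 ≤ N := by
  rw [sFiber, mem_filter, mem_Icc]

/-- **The sum over the disc in coordinates**: `Σ_{z primary, 1 ≤ |z|² ≤ N} F(z) = Σ_r Σ_{s ∈ sFiber N r} F(r + is)`.
[folklore] -/
private theorem sum_primaryNormLE_eq (N : ℕ) (F : GaussianInt → ℂ) :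
    ∑ z ∈ primaryNormLE N, F z = ∑ r ∈ rRange N, ∑ s ∈ sFiber N r, F ⟨r, s⟩ := by
  set R : ℤ := (Nat.sqrt N : ℤ) with hR
  have hset : primaryNormLE N =
      (((rRange N) ×ˢ (Icc (-R) R)).filter fun p : ℤ × ℤ =>
        Odd p.1 ∧ (4 : ℤ) ∣ p.1 + p.2 - 1 ∧ p.1 ^ 2 + p.2 ^ 2 ≤ N).image
        fun p => (⟨p.1, p.2⟩ : GaussianInt) := by
    ext z
    rw [mem_primaryNormLE, mem_image]
    constructor
    · rintro ⟨hp, h1, hN⟩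
      rw [isPrimary_iff_odd_and_dvd] at hp
      rw [show z.norm = z.re ^ 2 + z.im ^ 2 by rw [Zsqrtd.norm_def]; ring] at h1 hN
      have hre : z.re.natAbs ≤ Nat.sqrt N := natAbs_le_sqrt (by nlinarith)
      have him : z.im.natAbs ≤ Nat.sqrt N := natAbs_le_sqrt (by nlinarith)
      refine ⟨(z.re, z.im), ?_, by ext <;> rfl⟩
      rw [mem_filter, mem_product, rRange, mem_Icc, mem_Icc]
      refine ⟨⟨⟨?_, ?_⟩, ?_, ?_⟩, hp.1, hp.2, hN⟩ <;> omega
    · rintro ⟨⟨r, s⟩, hrs, rfl⟩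
      rw [mem_filter] at hrs
      obtain ⟨-, hodd, hdvd, hN⟩ := hrs
      refine ⟨(isPrimary_iff_odd_and_dvd _).mpr ⟨hodd, hdvd⟩, ?_, ?_⟩
      · rw [norm_mk]
        have hr0 : r ≠ 0 := by rintro rfl; simp at hodd
        nlinarith [sq_nonneg s, sq_pos_of_ne_zero hr0]
      · rw [norm_mk]; exact hN
  rw [hset, sum_image]
  · rw [sum_filter, sum_product]
    refine sum_congr rfl fun r _ => ?_
    rw [sFiber, sum_filter]
  · rintro ⟨r, s⟩ _ ⟨r', s'⟩ _ h
    simp only [Zsqrtd.ext_iff] at h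
    exact Prod.ext h.1 h.2

/-- The fibres are small: `#sFiber N r ≤ 2⌊√N⌋ + 1`. [folklore] -/
private theorem card_sFiber_le (N : ℕ) (r : ℤ) : (sFiber N r).card ≤ 2 * Nat.sqrt N + 1 := by
  calc (sFiber N r).card ≤ (Icc (-(Nat.sqrt N : ℤ)) (Nat.sqrt N : ℤ)).card := card_filter_le _ _
    _ = 2 * Nat.sqrt N + 1 := by
        rw [Int.card_Icc]
        have : ((Nat.sqrt N : ℤ) + 1 - -(Nat.sqrt N : ℤ)) = ((2 * Nat.sqrt N + 1 : ℕ) : ℤ) := by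
          push_cast; ring
        rw [this, Int.toNat_natCast]

/-! ### The weights: bounds for `ψ`, `[·]` -/

/-- The angular character `(z/|z|)^k`. [cite: FriedlanderIwaniecAnnals1998, (17.17)] -/
private def ang (k : ℤ) (z : GaussianInt) : ℂ := (toComplex z / (‖toComplex z‖ : ℂ)) ^ k

/-- `ψ = χ · ang`. [cite: FriedlanderIwaniecAnnals1998, (17.17)] -/
private theorem heckePsi_eq_mul_ang (d : ℕ) (χ : MulChar (GaussQuot (4 * d)) ℂ) (k : ℤ)
    (z : GaussianInt) : heckePsi d χ k z = χ (toQuot (4 * d) z) * ang k z := rfl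

/-- `|(z/|z|)^k| ≤ 1`. [cite: FriedlanderIwaniecAnnals1998, (17.17)] -/
private theorem norm_ang_le_one (k : ℤ) (z : GaussianInt) : ‖ang k z‖ ≤ 1 := by
  rw [ang, norm_zpow]
  have h : ‖toComplex z / (‖toComplex z‖ : ℂ)‖ ≤ 1 := by
    rw [norm_div, Complex.norm_real, Real.norm_eq_abs, abs_norm]
    exact div_self_le_one _
  have h0 : 0 ≤ ‖toComplex z / (‖toComplex z‖ : ℂ)‖ := norm_nonneg _
  rcases le_or_gt 0 k with hk | hk
  · obtain ⟨n, rfl⟩ := Int.eq_ofNat_of_zero_le hk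
    rw [zpow_natCast]; exact pow_le_one₀ h0 h
  · -- negative power: the base has norm `0` or `1`
    by_cases hz : toComplex z = 0
    · rw [hz, zero_div, norm_zero, zero_zpow k (by omega)]; exact zero_le_one
    · have h1 : ‖toComplex z / (‖toComplex z‖ : ℂ)‖ = 1 := by
        rw [norm_div, Complex.norm_real, Real.norm_eq_abs, abs_norm, div_self (norm_ne_zero_iff.mpr hz)]
      rw [h1, one_zpow]

/-- `|ψ(z)| ≤ 1` for the Hecke character (17.17). [cite: FriedlanderIwaniecAnnals1998, (17.17)] -/
theorem norm_heckePsi_le_one (d : ℕ) [NeZero d] (χ : MulChar (GaussQuot (4 * d)) ℂ) (k : ℤ)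
    (z : GaussianInt) : ‖heckePsi d χ k z‖ ≤ 1 := by
  haveI : NeZero (4 * d) := ⟨by have := NeZero.ne d; omega⟩
  rw [heckePsi_eq_mul_ang, norm_mul]
  calc ‖χ (toQuot (4 * d) z)‖ * ‖ang k z‖ ≤ 1 * 1 :=
        mul_le_mul (norm_mulChar_apply_le_one χ _) (norm_ang_le_one k z) (norm_nonneg _) zero_le_one
    _ = 1 := one_mul _

/-- `|(a/b)| ≤ 1` in `ℂ`. [folklore] -/
private theorem norm_intCast_jacobiSym_le_one (a : ℤ) (b : ℕ) : ‖((J(a | b) : ℤ) : ℂ)‖ ≤ 1 := by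
  rcases jacobiSym.trichotomy a b with h | h | h <;> rw [h] <;> simp

/-- `|i^e| = 1`. [folklore] -/
private theorem norm_I_zpow (e : ℤ) : ‖Complex.I ^ e‖ = 1 := by
  rw [norm_zpow, Complex.norm_I, one_zpow]

/-- `|[z]| ≤ 1` for the Jacobi–Kubota symbol (20.1). [cite: FriedlanderIwaniecAnnals1998, (20.1)] -/
theorem norm_jacobiKubota_le_one (z : GaussianInt) : ‖jacobiKubota z‖ ≤ 1 := by
  rw [jacobiKubota_def, norm_mul, norm_I_zpow, one_mul]
  exact norm_intCast_jacobiSym_le_one _ _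

/-! ### Lemma 20.1 applied to a term of `𝒦(N)` -/

/-- For `w` primary primitive with `(z/w) = ((r + ωs)/q)` and `z = r + is ≡ 1 (mod 2)`:
`ψ(z)[wz] = [w] i^{(r-1)/2} · ε(w,z) ψ(z) (s/|r|) ((r+ωs)/q)` ((22.6) with (19.2), (20.1)).
[cite: FriedlanderIwaniecAnnals1998, (22.6)–(22.7)] -/
private theorem term_eq {w : GaussianInt} (hw : IsPrimary w) (hw' : IsPrimitive w) {ω : ℤ}
    (hω : ∀ z : GaussianInt, dirichletSym z w = J(z.re + ω * z.im | w.norm.natAbs))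
    (d : ℕ) (χ : MulChar (GaussQuot (4 * d)) ℂ) (k : ℤ) {r s : ℤ} (hr : Odd r) (hs : Even s) :
    heckePsi d χ k ⟨r, s⟩ * jacobiKubota (w * ⟨r, s⟩) =
      jacobiKubota w * Complex.I ^ ((r - 1) / 2) *
        ((kubotaEps w.re w.im r s : ℂ) * heckePsi d χ k ⟨r, s⟩ *
          ((J(s | r.natAbs) * J(r + ω * s | w.norm.natAbs) : ℤ) : ℂ)) := by
  have h := jacobiKubota_mul (z := ⟨r, s⟩) hw hw' hr hs
  rw [h, jacobiKubota_def ⟨r, s⟩, hω ⟨r, s⟩]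
  push_cast
  ring

/-- If `w` is not primitive then `[wz] = 0` for every `z ≡ 1 (mod 2)` (the product `wz` is not
primitive and has odd real part). [cite: FriedlanderIwaniecAnnals1998, §22 (proof of (22.3))] -/
private theorem jacobiKubota_mul_eq_zero_of_not_isPrimitive {w z : GaussianInt} (hw : IsPrimary w)
    (hw' : ¬ IsPrimitive w) (hz : IsPrimary z) : jacobiKubota (w * z) = 0 := by
  have hwz : IsPrimary (w * z) := hw.mul hz
  refine jacobiKubota_eq_zero_of_not_isPrimitive ?_ ?_
  · intro hprim
    -- `g = gcd(re w, im w) > 1` divides `w`, hence `wz`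
    have hg : Int.gcd w.re w.im ≠ 1 := hw'
    have hg0 : Int.gcd w.re w.im ≠ 0 := by
      intro h0; rw [Int.gcd_eq_zero_iff] at h0
      exact hw.ne_zero (Zsqrtd.ext h0.1 h0.2)
    have hg1 : 1 < Int.gcd w.re w.im := by omega
    have hdvd : ((Int.gcd w.re w.im : ℕ) : GaussianInt) ∣ w := by
      rw [natCast_dvd_iff]; exact ⟨Int.gcd_dvd_left _ _, Int.gcd_dvd_right _ _⟩
    exact not_natCast_dvd_of_isPrimitive hprim hg1 (hdvd.mul_right z)
  · have := re_odd_of_isPrimary hwz; omega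

/-! ### The translation `s = t + ω r` -/

/-- `(t + ωr / |r|) ((r + ω(t + ωr))/q) = (ω/q) (t/(|r| q))` for `q ∣ ω² + 1`.
[cite: FriedlanderIwaniecAnnals1998, §22 (proof of (22.3))] -/
private theorem jacobiSym_shift {q : ℕ} {ω r : ℤ} (hq : (q : ℤ) ∣ ω ^ 2 + 1) (hr : r ≠ 0) (hq0 : q ≠ 0)
    (t : ℤ) : J(t + ω * r | r.natAbs) * J(r + ω * (t + ω * r) | q) = J(ω | q) * J(t | r.natAbs * q) := by
  have h1 : J(t + ω * r | r.natAbs) = J(t | r.natAbs) := by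
    refine jacobiSym.mod_left' ?_
    obtain ⟨c, hc⟩ : (r.natAbs : ℤ) ∣ ω * r := Int.natAbs_dvd.mpr (dvd_mul_left r ω)
    rw [hc, Int.add_mul_emod_self_left]
  have h2 : J(r + ω * (t + ω * r) | q) = J(ω * t | q) := by
    refine jacobiSym.mod_left' ?_
    obtain ⟨c, hc⟩ := hq
    have : r + ω * (t + ω * r) = ω * t + (q : ℤ) * (c * r) := by
      have : ω ^ 2 * r + r = (q : ℤ) * c * r := by rw [← hc]; ring
      linear_combination this
    rw [this, Int.add_mul_emod_self_left]
  rw [h1, h2, jacobiSym.mul_left, jacobiSym.mul_right' t (Int.natAbs_ne_zero.mpr hr) hq0]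
  ring

/-- Reindexing the `s`-sum by `t = s - ωr`. [folklore] -/
private theorem sum_shift (S : Finset ℤ) (c : ℤ) (Φ : ℤ → ℂ) :
    ∑ s ∈ S, Φ s = ∑ t ∈ S.image (· - c), Φ (t + c) := by
  rw [sum_image (fun x _ y _ h => by simpa using h)]
  simp

/-! ### Bounded variation along a line: generic lemmas -/

/-- Variation of a product of two bounded sequences. [folklore] -/
private theorem sum_norm_mul_sub_mul_le (S : Finset ℤ) (g e : ℤ → ℂ) (hg : ∀ u, ‖g u‖ ≤ 1)
    (he : ∀ u, ‖e u‖ ≤ 1) :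
    ∑ u ∈ S, ‖g (u + 1) * e (u + 1) - g u * e u‖ ≤
      ∑ u ∈ S, ‖g (u + 1) - g u‖ + ∑ u ∈ S, ‖e (u + 1) - e u‖ := by
  rw [← sum_add_distrib]
  refine sum_le_sum fun u _ => ?_
  have h : g (u + 1) * e (u + 1) - g u * e u = (g (u + 1) - g u) * e (u + 1) + g u * (e (u + 1) - e u) := by
    ring
  rw [h]
  calc ‖(g (u + 1) - g u) * e (u + 1) + g u * (e (u + 1) - e u)‖
      ≤ ‖(g (u + 1) - g u) * e (u + 1)‖ + ‖g u * (e (u + 1) - e u)‖ := norm_add_le _ _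
    _ = ‖g (u + 1) - g u‖ * ‖e (u + 1)‖ + ‖g u‖ * ‖e (u + 1) - e u‖ := by rw [norm_mul, norm_mul]
    _ ≤ ‖g (u + 1) - g u‖ * 1 + 1 * ‖e (u + 1) - e u‖ :=
        add_le_add (mul_le_mul_of_nonneg_left (he _) (norm_nonneg _))
          (mul_le_mul_of_nonneg_right (hg _) (norm_nonneg _))
    _ = ‖g (u + 1) - g u‖ + ‖e (u + 1) - e u‖ := by ring

/-- Variation of a monotone or antitone real sequence with values in `[m, M]` along an interval is at
most `M - m`. [folklore] -/
private theorem sum_abs_sub_le_of_monotone {S : Finset ℤ} (hS : IsZInterval S) (f : ℤ → ℝ) {m M : ℝ}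
    (hmono : Monotone f ∨ Antitone f) (hm : ∀ u, m ≤ f u) (hM : ∀ u, f u ≤ M) :
    ∑ u ∈ S.filter (fun u => u + 1 ∈ S), |f (u + 1) - f u| ≤ M - m := by
  rcases S.eq_empty_or_nonempty with rfl | hne
  · simp; linarith [hm 0, hM 0]
  set A := S.min' hne
  set B := S.max' hne
  have hSeq : S = Icc A B := hS.eq_Icc hne
  have hAB : A ≤ B := S.min'_le B (S.max'_mem hne)
  have hset : S.filter (fun u => u + 1 ∈ S) = Icc A (B - 1) := by
    rw [hSeq]; ext u; simp only [mem_filter, mem_Icc]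
    constructor
    · rintro ⟨⟨h1, -⟩, -, h4⟩; exact ⟨h1, by linarith⟩
    · rintro ⟨h1, h2⟩; exact ⟨⟨h1, by linarith⟩, by linarith, by linarith⟩
  rw [hset, sum_Icc_int_eq_sum_range]
  set n := (B - 1 + 1 - A).toNat with hn
  have hn' : (n : ℤ) = B - A := by rw [hn, Int.toNat_of_nonneg (by linarith)]; ring
  have htel : ∀ g : ℤ → ℝ, ∑ j ∈ range n, (g (A + (j : ℕ) + 1) - g (A + (j : ℕ))) = g B - g A := by
    intro g
    have := Finset.sum_range_sub (fun j : ℕ => g (A + j)) n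
    simp only [Nat.cast_add, Nat.cast_one] at this
    rw [show (A + (n : ℤ)) = B by rw [hn']; ring, Nat.cast_zero, add_zero] at this
    rw [← this]
    refine sum_congr rfl fun j _ => ?_
    ring_nf
  rcases hmono with hmono | hanti
  · calc ∑ j ∈ range n, |f (A + (j : ℕ) + 1) - f (A + (j : ℕ))|
        = ∑ j ∈ range n, (f (A + (j : ℕ) + 1) - f (A + (j : ℕ))) := by
          refine sum_congr rfl fun j _ => abs_of_nonneg ?_
          linarith [hmono (show A + (j : ℕ) ≤ A + (j : ℕ) + 1 by linarith)]
      _ = f B - f A := htel f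
      _ ≤ M - m := by linarith [hM B, hm A]
  · calc ∑ j ∈ range n, |f (A + (j : ℕ) + 1) - f (A + (j : ℕ))|
        = ∑ j ∈ range n, ((-f) (A + (j : ℕ) + 1) - (-f) (A + (j : ℕ))) := by
          refine sum_congr rfl fun j _ => ?_
          rw [abs_of_nonpos (by linarith [hanti (show A + (j : ℕ) ≤ A + (j : ℕ) + 1 by linarith)])]
          simp only [Pi.neg_apply]; ring
      _ = (-f) B - (-f) A := htel (-f)
      _ ≤ M - m := by simp only [Pi.neg_apply]; linarith [hM A, hm B]

/-- `‖a^k - b^k‖ ≤ |k| ‖a - b‖` for unimodular `a, b`. [folklore] -/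
private theorem norm_zpow_sub_zpow_le {a b : ℂ} (ha : ‖a‖ = 1) (hb : ‖b‖ = 1) (k : ℤ) :
    ‖a ^ k - b ^ k‖ ≤ |(k : ℝ)| * ‖a - b‖ := by
  have hnat : ∀ {x y : ℂ}, ‖x‖ = 1 → ‖y‖ = 1 → ∀ n : ℕ, ‖x ^ n - y ^ n‖ ≤ n * ‖x - y‖ := by
    intro x y hx hy n
    induction n with
    | zero => simp
    | succ n ih =>
      have h : x ^ (n + 1) - y ^ (n + 1) = x * (x ^ n - y ^ n) + (x - y) * y ^ n := by ring
      rw [h]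
      calc ‖x * (x ^ n - y ^ n) + (x - y) * y ^ n‖
          ≤ ‖x * (x ^ n - y ^ n)‖ + ‖(x - y) * y ^ n‖ := norm_add_le _ _
        _ = ‖x ^ n - y ^ n‖ + ‖x - y‖ := by rw [norm_mul, norm_mul, hx, norm_pow, hy]; simp
        _ ≤ n * ‖x - y‖ + ‖x - y‖ := by linarith [ih]
        _ = (n + 1 : ℕ) * ‖x - y‖ := by push_cast; ring
  rcases Int.eq_nat_or_neg k with ⟨n, rfl | rfl⟩
  · rw [zpow_natCast, zpow_natCast]
    calc ‖a ^ n - b ^ n‖ ≤ n * ‖a - b‖ := hnat ha hb n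
      _ = |((n : ℤ) : ℝ)| * ‖a - b‖ := by simp
  · rw [zpow_neg, zpow_neg, zpow_natCast, zpow_natCast, ← inv_pow, ← inv_pow,
      Complex.inv_eq_conj ha, Complex.inv_eq_conj hb]
    have hca : ‖(starRingEnd ℂ) a‖ = 1 := by rw [Complex.norm_conj, ha]
    have hcb : ‖(starRingEnd ℂ) b‖ = 1 := by rw [Complex.norm_conj, hb]
    calc ‖(starRingEnd ℂ) a ^ n - (starRingEnd ℂ) b ^ n‖ ≤ n * ‖(starRingEnd ℂ) a - (starRingEnd ℂ) b‖ :=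
          hnat hca hcb n
      _ = n * ‖a - b‖ := by rw [← map_sub, Complex.norm_conj]
      _ = |((-(n : ℤ) : ℤ) : ℝ)| * ‖a - b‖ := by simp

/-- The unit vector of `r + is`, `r ≠ 0`, is `sign(r) e^{i arctan(s/r)}`. [folklore] -/
private theorem unit_eq_sign_mul_exp {r : ℤ} (hr : r ≠ 0) (s : ℤ) :
    toComplex ⟨r, s⟩ / (‖toComplex ⟨r, s⟩‖ : ℂ) =
      (Int.sign r : ℂ) * Complex.exp (Complex.I * Real.arctan ((s : ℝ) / r)) := by
  have hr' : (r : ℝ) ≠ 0 := by exact_mod_cast hr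
  set x : ℝ := (s : ℝ) / r with hx
  have hnorm : ‖toComplex ⟨r, s⟩‖ = Real.sqrt ((r : ℝ) ^ 2 + (s : ℝ) ^ 2) := by
    rw [toComplex_def']
    have := Complex.norm_add_mul_I (r : ℝ) (s : ℝ)
    push_cast at this ⊢
    exact this
  have hpos : 0 < (r : ℝ) ^ 2 + (s : ℝ) ^ 2 := by positivity
  have hsq : Real.sqrt (1 + x ^ 2) * |(r : ℝ)| = Real.sqrt ((r : ℝ) ^ 2 + (s : ℝ) ^ 2) := by
    rw [← Real.sqrt_sq_eq_abs, ← Real.sqrt_mul' _ (sq_nonneg _)]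
    congr 1
    rw [hx]; field_simp
  have hsq0 : Real.sqrt (1 + x ^ 2) ≠ 0 := (Real.sqrt_pos.mpr (by positivity)).ne'
  have habs0 : |(r : ℝ)| ≠ 0 := abs_ne_zero.mpr hr'
  -- `sign r * |r| = r`
  have hsign : ((Int.sign r : ℤ) : ℝ) * |(r : ℝ)| = r := by
    rcases lt_or_gt_of_ne hr with h | h
    · rw [Int.sign_eq_neg_one_of_neg h, abs_of_neg (by exact_mod_cast h)]; push_cast; ring
    · rw [Int.sign_eq_one_of_pos h, abs_of_pos (by exact_mod_cast h)]; push_cast; ring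
  rw [mul_comm Complex.I, Complex.exp_mul_I, ← Complex.ofReal_cos, ← Complex.ofReal_sin,
    Real.cos_arctan, Real.sin_arctan, hnorm, toComplex_def']
  -- compare real and imaginary parts after clearing denominators
  have hS0 : (Real.sqrt ((r : ℝ) ^ 2 + (s : ℝ) ^ 2) : ℂ) ≠ 0 := by
    exact_mod_cast (Real.sqrt_pos.mpr hpos).ne'
  rw [div_eq_iff hS0]
  have key_re : (r : ℝ) = (Int.sign r : ℝ) * (1 / Real.sqrt (1 + x ^ 2)) * Real.sqrt ((r : ℝ) ^ 2 + (s : ℝ) ^ 2) := by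
    rw [← hsq]; field_simp; linarith [hsign]
  have key_im : (s : ℝ) = (Int.sign r : ℝ) * (x / Real.sqrt (1 + x ^ 2)) * Real.sqrt ((r : ℝ) ^ 2 + (s : ℝ) ^ 2) := by
    rw [← hsq]
    have : (Int.sign r : ℝ) * (x / Real.sqrt (1 + x ^ 2)) * (Real.sqrt (1 + x ^ 2) * |(r : ℝ)|) =
        x * ((Int.sign r : ℝ) * |(r : ℝ)|) := by field_simp
    rw [this]
    rw [hsign, hx]; field_simp
  apply Complex.ext
  · simp only [Complex.add_re, Complex.ofReal_re, Complex.mul_re, Complex.ofReal_im, Complex.I_re,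
      Complex.I_im, Complex.mul_im, Complex.add_im, Complex.intCast_re, Complex.intCast_im]
    nlinarith [key_re]
  · simp only [Complex.add_re, Complex.ofReal_re, Complex.mul_re, Complex.ofReal_im, Complex.I_re,
      Complex.I_im, Complex.mul_im, Complex.add_im, Complex.intCast_re, Complex.intCast_im]
    nlinarith [key_im]

/-- **The sector character has variation `≤ π|k|` along a vertical line** `z = r + i(c + Du)`
(`r ≠ 0`, `D > 0`): the source's "application of partial summation which is needed to remove the
sector character" costs the factor `|k| + 1`. [cite: FriedlanderIwaniecAnnals1998, §22 (proof of (22.3))] -/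
private theorem sum_norm_ang_sub_le {r : ℤ} (hr : r ≠ 0) (k c : ℤ) {D : ℤ} (hD : 0 < D)
    {U : Finset ℤ} (hU : IsZInterval U) :
    ∑ u ∈ U.filter (fun u => u + 1 ∈ U), ‖ang k ⟨r, c + D * (u + 1)⟩ - ang k ⟨r, c + D * u⟩‖ ≤
      |(k : ℝ)| * Real.pi := by
  set θ : ℤ → ℝ := fun u => Real.arctan (((c + D * u : ℤ) : ℝ) / r) with hθ
  have hunit : ∀ u : ℤ, toComplex ⟨r, c + D * u⟩ / (‖toComplex ⟨r, c + D * u⟩‖ : ℂ) =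
      (Int.sign r : ℂ) * Complex.exp (Complex.I * θ u) := fun u => unit_eq_sign_mul_exp hr _
  have hsign1 : ‖(Int.sign r : ℂ)‖ = 1 := by
    rcases lt_or_gt_of_ne hr with h | h
    · rw [Int.sign_eq_neg_one_of_neg h]; simp
    · rw [Int.sign_eq_one_of_pos h]; simp
  have hexp1 : ∀ t : ℝ, ‖Complex.exp (Complex.I * t)‖ = 1 := fun t => by
    rw [mul_comm, Complex.norm_exp_ofReal_mul_I]
  have hnorm1 : ∀ u : ℤ, ‖toComplex ⟨r, c + D * u⟩ / (‖toComplex ⟨r, c + D * u⟩‖ : ℂ)‖ = 1 := by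
    intro u; rw [hunit u, norm_mul, hsign1, hexp1, one_mul]
  have hterm : ∀ u : ℤ, ‖ang k ⟨r, c + D * (u + 1)⟩ - ang k ⟨r, c + D * u⟩‖ ≤
      |(k : ℝ)| * |θ (u + 1) - θ u| := by
    intro u
    rw [ang, ang]
    refine (norm_zpow_sub_zpow_le (hnorm1 _) (hnorm1 _) k).trans ?_
    refine mul_le_mul_of_nonneg_left ?_ (abs_nonneg _)
    rw [hunit, hunit, ← mul_sub, norm_mul, hsign1, one_mul]
    have h : Complex.exp (Complex.I * θ (u + 1)) - Complex.exp (Complex.I * θ u) =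
        Complex.exp (Complex.I * θ u) * (Complex.exp (Complex.I * ((θ (u + 1) - θ u : ℝ) : ℂ)) - 1) := by
      rw [mul_sub, mul_one, ← Complex.exp_add]
      congr 1; push_cast; ring
    rw [h, norm_mul, hexp1, one_mul]
    exact (Real.norm_exp_I_mul_ofReal_sub_one_le).trans (le_of_eq (Real.norm_eq_abs _))
  -- monotonicity of `θ`
  have hr' : (r : ℝ) ≠ 0 := by exact_mod_cast hr
  have hmono : Monotone θ ∨ Antitone θ := by
    rcases lt_or_gt_of_ne hr with h | h
    · right
      intro u u' huu'
      apply Real.arctan_strictMono.monotone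
      have hr0 : (r : ℝ) < 0 := by exact_mod_cast h
      rw [div_le_div_right_of_neg hr0]
      have : ((c + D * u : ℤ) : ℝ) ≤ ((c + D * u' : ℤ) : ℝ) := by
        exact_mod_cast (by nlinarith : c + D * u ≤ c + D * u')
      exact this
    · left
      intro u u' huu'
      apply Real.arctan_strictMono.monotone
      have hr0 : (0 : ℝ) < r := by exact_mod_cast h
      rw [div_le_div_iff_of_pos_right hr0]
      exact_mod_cast (by nlinarith : c + D * u ≤ c + D * u')
  have hvar := sum_abs_sub_le_of_monotone hU θ hmono (m := -(Real.pi / 2)) (M := Real.pi / 2)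
    (fun u => (Real.neg_pi_div_two_lt_arctan _).le) (fun u => (Real.arctan_lt_pi_div_two _).le)
  calc ∑ u ∈ U.filter (fun u => u + 1 ∈ U), ‖ang k ⟨r, c + D * (u + 1)⟩ - ang k ⟨r, c + D * u⟩‖
      ≤ ∑ u ∈ U.filter (fun u => u + 1 ∈ U), |(k : ℝ)| * |θ (u + 1) - θ u| := sum_le_sum fun u _ => hterm u
    _ = |(k : ℝ)| * ∑ u ∈ U.filter (fun u => u + 1 ∈ U), |θ (u + 1) - θ u| := by rw [mul_sum]
    _ ≤ |(k : ℝ)| * (Real.pi / 2 - -(Real.pi / 2)) := mul_le_mul_of_nonneg_left hvar (abs_nonneg _)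
    _ = |(k : ℝ)| * Real.pi := by ring

/-- `|(x, y)_∞| = 1`. [cite: FriedlanderIwaniecAnnals1998, (17.7)] -/
private theorem abs_hilbertInfty (x y : ℤ) : |hilbertInfty x y| = 1 := by
  unfold hilbertInfty; split_ifs <;> simp

/-- `|ε(w, z)| = 1`. [cite: FriedlanderIwaniecAnnals1998, (20.5)–(20.6)] -/
private theorem abs_kubotaEps (u v r s : ℤ) : |kubotaEps u v r s| = 1 := by
  rw [kubotaEps_def]; split_ifs <;> rw [abs_mul, abs_hilbertInfty, abs_hilbertInfty, mul_one]

/-- **The sign `ε(w, z)` of Lemma 20.1 changes at most once along a vertical line**: for fixed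
`w = u₀ + iv` and `r`, `s ↦ ε` is constant on `{u₀ r > v s}` and on its complement, so its variation
along `s = c + Du` is `≤ 2` (the source instead splits the box into sectors keeping the quadrants of
`z`, `wz` fixed). [cite: FriedlanderIwaniecAnnals1998, §22 (proof of (22.3), after (22.6))] -/
private theorem sum_norm_kubotaEps_sub_le (u₀ v r c : ℤ) {D : ℤ} (hD : 0 < D) {U : Finset ℤ}
    (hU : IsZInterval U) :
    ∑ u ∈ U.filter (fun u => u + 1 ∈ U),
      ‖((kubotaEps u₀ v r (c + D * (u + 1)) : ℤ) : ℂ) - ((kubotaEps u₀ v r (c + D * u) : ℤ) : ℂ)‖ ≤ 2 := by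
  set c₁ : ℤ := hilbertInfty u₀ v * hilbertInfty r (-v) with hc₁
  set c₂ : ℤ := hilbertInfty u₀ v * hilbertInfty (-r) v with hc₂
  set f : ℤ → ℝ := fun u => if 0 < u₀ * r - v * (c + D * u) then 1 else 0 with hf
  have hE : ∀ u : ℤ, (kubotaEps u₀ v r (c + D * u) : ℝ) = c₂ + (c₁ - c₂) * f u := by
    intro u
    rw [kubotaEps_def]
    simp only [hf, hc₁, hc₂]
    split_ifs <;> push_cast <;> ring
  have hc12 : |((c₁ - c₂ : ℤ) : ℝ)| ≤ 2 := by
    have h1 : |(c₁ : ℝ)| = 1 := by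
      rw [hc₁]; push_cast; rw [abs_mul]
      have := abs_hilbertInfty u₀ v; have := abs_hilbertInfty r (-v)
      rw [show |(hilbertInfty u₀ v : ℝ)| = 1 by exact_mod_cast abs_hilbertInfty u₀ v,
        show |(hilbertInfty r (-v) : ℝ)| = 1 by exact_mod_cast abs_hilbertInfty r (-v), mul_one]
    have h2 : |(c₂ : ℝ)| = 1 := by
      rw [hc₂]; push_cast; rw [abs_mul]
      rw [show |(hilbertInfty u₀ v : ℝ)| = 1 by exact_mod_cast abs_hilbertInfty u₀ v,
        show |(hilbertInfty (-r) v : ℝ)| = 1 by exact_mod_cast abs_hilbertInfty (-r) v, mul_one]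
    push_cast
    calc |(c₁ : ℝ) - c₂| ≤ |(c₁ : ℝ)| + |(c₂ : ℝ)| := abs_sub _ _
      _ = 2 := by rw [h1, h2]; norm_num
  -- monotonicity of the indicator
  have hmono : Monotone f ∨ Antitone f := by
    rcases le_or_gt 0 v with hv | hv
    · right
      intro u u' huu'
      simp only [hf]
      by_cases h' : 0 < u₀ * r - v * (c + D * u')
      · have hDu : D * u ≤ D * u' := mul_le_mul_of_nonneg_left huu' hD.le
        have hv' : v * (c + D * u) ≤ v * (c + D * u') := mul_le_mul_of_nonneg_left (by linarith) hv
        have h : 0 < u₀ * r - v * (c + D * u) := by linarith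
        rw [if_pos h', if_pos h]
      · rw [if_neg h']; split_ifs <;> norm_num
    · left
      intro u u' huu'
      simp only [hf]
      by_cases h : 0 < u₀ * r - v * (c + D * u)
      · have hDu : D * u ≤ D * u' := mul_le_mul_of_nonneg_left huu' hD.le
        have hv' : v * (c + D * u') ≤ v * (c + D * u) := mul_le_mul_of_nonpos_left (by linarith) hv.le
        have h' : 0 < u₀ * r - v * (c + D * u') := by linarith
        rw [if_pos h', if_pos h]
      · rw [if_neg h]; split_ifs <;> norm_num
  have hvar := sum_abs_sub_le_of_monotone hU f hmono (m := 0) (M := 1)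
    (fun u => by simp only [hf]; split_ifs <;> norm_num) (fun u => by simp only [hf]; split_ifs <;> norm_num)
  calc ∑ u ∈ U.filter (fun u => u + 1 ∈ U),
        ‖((kubotaEps u₀ v r (c + D * (u + 1)) : ℤ) : ℂ) - ((kubotaEps u₀ v r (c + D * u) : ℤ) : ℂ)‖
      = ∑ u ∈ U.filter (fun u => u + 1 ∈ U), |((c₁ - c₂ : ℤ) : ℝ)| * |f (u + 1) - f u| := by
        refine sum_congr rfl fun u _ => ?_
        rw [← Complex.ofReal_intCast, ← Complex.ofReal_intCast, ← Complex.ofReal_sub, Complex.norm_real,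
          Real.norm_eq_abs, hE, hE, ← abs_mul]
        congr 1; push_cast; ring
    _ = |((c₁ - c₂ : ℤ) : ℝ)| * ∑ u ∈ U.filter (fun u => u + 1 ∈ U), |f (u + 1) - f u| := by rw [mul_sum]
    _ ≤ 2 * (1 - 0) := mul_le_mul hc12 hvar (sum_nonneg fun _ _ => abs_nonneg _) (by norm_num)
    _ = 2 := by norm_num

/-- The weight `h(u) = ε · (z/|z|)^k` along the line has variation `≤ 2 + π|k|`.
[cite: FriedlanderIwaniecAnnals1998, §22 (proof of (22.3))] -/
private theorem sum_norm_weight_sub_le (u₀ v : ℤ) {r : ℤ} (hr : r ≠ 0) (k c : ℤ) {D : ℤ} (hD : 0 < D)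
    {U : Finset ℤ} (hU : IsZInterval U) :
    ∑ u ∈ U.filter (fun u => u + 1 ∈ U),
      ‖((kubotaEps u₀ v r (c + D * (u + 1)) : ℤ) : ℂ) * ang k ⟨r, c + D * (u + 1)⟩ -
        ((kubotaEps u₀ v r (c + D * u) : ℤ) : ℂ) * ang k ⟨r, c + D * u⟩‖ ≤ 2 + Real.pi * |(k : ℝ)| := by
  have h := sum_norm_mul_sub_mul_le (U.filter (fun u => u + 1 ∈ U))
    (fun u => ((kubotaEps u₀ v r (c + D * u) : ℤ) : ℂ)) (fun u => ang k ⟨r, c + D * u⟩)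
    (fun u => by
      rw [Complex.norm_intCast]
      exact le_of_eq (by exact_mod_cast abs_kubotaEps u₀ v r (c + D * u)))
    (fun u => norm_ang_le_one k _)
  have h1 := sum_norm_kubotaEps_sub_le u₀ v r c hD hU
  have h2 := sum_norm_ang_sub_le hr k c hD hU
  have h2' : ∑ u ∈ U.filter (fun u => u + 1 ∈ U), ‖ang k ⟨r, c + D * (u + 1)⟩ - ang k ⟨r, c + D * u⟩‖ ≤
      Real.pi * |(k : ℝ)| := by rw [mul_comm]; exact h2
  refine h.trans ?_
  have h1' : ∑ u ∈ U.filter (fun u => u + 1 ∈ U),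
      ‖((kubotaEps u₀ v r (c + D * (u + 1)) : ℤ) : ℂ) - ((kubotaEps u₀ v r (c + D * u) : ℤ) : ℂ)‖ ≤ 2 := h1
  linarith [h1', h2']

/-! ### One residue class modulo `4d`: Abel summation and Pólya–Vinogradov -/

/-- **A class `t ≡ b (mod D)` for non-degenerate modulus**: `‖Σ_{u ∈ U} ((b + Du)/Q) h(u)‖ ≤
√Q (1 + log Q) (3 + π|k|)` for the weight `h = ε · (z/|z|)^k` along the line and any interval `U`.
[cite: FriedlanderIwaniecAnnals1998, §22 (proof of (22.3))] -/
private theorem norm_class_sum_le {Q : ℕ} (hQ : Odd Q) {D : ℕ} (hD : 0 < D) (hnd : ¬ APSquareClass Q D)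
    (u₀ v : ℤ) {r : ℤ} (hr : r ≠ 0) (k b c : ℤ) {U : Finset ℤ} (hU : IsZInterval U) :
    ‖∑ u ∈ U, ((J(b + D * u | Q) : ℤ) : ℂ) *
        (((kubotaEps u₀ v r (c + D * u) : ℤ) : ℂ) * ang k ⟨r, c + D * u⟩)‖ ≤
      Real.sqrt Q * (1 + Real.log Q) * (3 + Real.pi * |(k : ℝ)|) := by
  have hQ0 : Q ≠ 0 := by rintro rfl; exact (Nat.not_odd_iff_even.mpr (by decide)) hQ
  have hlog : 0 ≤ Real.log (Q : ℝ) := Real.log_nonneg (by exact_mod_cast Nat.pos_of_ne_zero hQ0)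
  have hD' : (0 : ℤ) < (D : ℤ) := by exact_mod_cast hD
  have h := norm_sum_mul_le_of_isZInterval hU (a := fun u => ((J(b + D * u | Q) : ℤ) : ℂ))
    (h := fun u => ((kubotaEps u₀ v r (c + D * u) : ℤ) : ℂ) * ang k ⟨r, c + D * u⟩)
    (P := Real.sqrt Q * (1 + Real.log Q)) (H := 1) (V := 2 + Real.pi * |(k : ℝ)|)
    (by positivity) zero_le_one ?_ ?_ ?_
  · calc _ ≤ Real.sqrt Q * (1 + Real.log Q) * (1 + (2 + Real.pi * |(k : ℝ)|)) := h
      _ = _ := by ring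
  · intro c'
    have hcast : (∑ u ∈ U.filter (· ≤ c'), ((J(b + D * u | Q) : ℤ) : ℂ)) =
        (((∑ u ∈ U.filter (· ≤ c'), J(b + D * u | Q) : ℤ) : ℝ) : ℂ) := by push_cast; rfl
    rw [hcast, Complex.norm_real, Real.norm_eq_abs]
    exact abs_sum_jacobiSym_linear_le hQ hD hnd b (hU.filter_le c')
  · intro u _
    rw [norm_mul, Complex.norm_intCast]
    calc |((kubotaEps u₀ v r (c + D * u) : ℤ) : ℝ)| * ‖ang k ⟨r, c + D * u⟩‖ ≤ 1 * 1 :=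
          mul_le_mul (le_of_eq (by exact_mod_cast abs_kubotaEps u₀ v r _)) (norm_ang_le_one k _)
            (norm_nonneg _) zero_le_one
      _ = 1 := one_mul _
  · exact sum_norm_weight_sub_le u₀ v hr k c hD' hU

/-- Splitting a sum over `T ⊆ ℤ` into the residue classes modulo `D > 0`. [folklore] -/
private theorem norm_sum_le_sum_classes (T : Finset ℤ) {D : ℕ} (hD : 0 < D) (G : ℤ → ℂ) {B : ℝ}
    (hB : ∀ b : ℕ, b < D → ‖∑ u ∈ apPreimage T b D, G (b + D * u)‖ ≤ B) :
    ‖∑ t ∈ T, G t‖ ≤ D * B := by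
  have hD' : (0 : ℤ) < (D : ℤ) := by exact_mod_cast hD
  have hmaps : ∀ t ∈ T, (t % (D : ℤ)).toNat ∈ range D := by
    intro t _
    rw [mem_range]
    have h0 : 0 ≤ t % (D : ℤ) := Int.emod_nonneg _ hD'.ne'
    have h1 : t % (D : ℤ) < D := Int.emod_lt_of_pos _ hD'
    omega
  rw [← sum_fiberwise_of_maps_to hmaps]
  calc ‖∑ b ∈ range D, ∑ t ∈ T.filter (fun t => (t % (D : ℤ)).toNat = b), G t‖
      ≤ ∑ b ∈ range D, ‖∑ t ∈ T.filter (fun t => (t % (D : ℤ)).toNat = b), G t‖ := norm_sum_le _ _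
    _ ≤ ∑ b ∈ range D, B := by
        refine sum_le_sum fun b hb => ?_
        rw [mem_range] at hb
        have hset : T.filter (fun t => (t % (D : ℤ)).toNat = b) =
            T.filter (fun t => t % (D : ℤ) = (b : ℤ) % (D : ℤ)) := by
          refine filter_congr fun t _ => ?_
          have h0 : 0 ≤ t % (D : ℤ) := Int.emod_nonneg _ hD'.ne'
          have hb' : (b : ℤ) % (D : ℤ) = b := Int.emod_eq_of_lt (by positivity) (by exact_mod_cast hb)
          rw [hb']
          omega
        rw [hset, sum_filter_modEq_eq_sum_apPreimage T b hD']
        exact hB b hb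
    _ = D * B := by rw [sum_const, card_range, nsmul_eq_mul]

/-- Between two integers whose squares are `≤ M`, every integer has square `≤ M`. [folklore] -/
private theorem sq_le_of_between {x y z M : ℤ} (hxz : x ≤ z) (hzy : z ≤ y) (hx : x ^ 2 ≤ M)
    (hy : y ^ 2 ≤ M) : z ^ 2 ≤ M := by
  rcases le_or_gt 0 z with hz | hz
  · nlinarith
  · nlinarith

/-- `χ` is constant along `z = r + i(c + 4d u)`. [cite: FriedlanderIwaniecAnnals1998, §22 (proof of (22.3))] -/
private theorem toQuot_mk_add_mul (d : ℕ) (r c u : ℤ) :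
    toQuot (4 * d) ⟨r, c + (4 * d : ℕ) * u⟩ = toQuot (4 * d) ⟨r, c⟩ := by
  rw [toQuot_eq_toQuot_iff]
  refine ⟨⟨0, u⟩, Zsqrtd.ext ?_ ?_⟩ <;> simp

/-- **The inner sum for a non-degenerate `r`**: for `r` odd with `q|r|` not in the square class of
`4d`, `‖Σ_{s ∈ I(r)} ε ψ(r+is) (s/|r|)((r+ωs)/q)‖ ≤ 4d · √(q|r|)(1 + log(q|r|)) (3 + π|k|)`.
[cite: FriedlanderIwaniecAnnals1998, §22 (proof of (22.3))] -/
private theorem norm_inner_le_good {q : ℕ} (hq0 : q ≠ 0) (hqodd : Odd q) {ω : ℤ}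
    (hω : (q : ℤ) ∣ ω ^ 2 + 1) {d : ℕ} (hd : 1 ≤ d) (χ : MulChar (GaussQuot (4 * d)) ℂ) (k : ℤ)
    (u₀ v : ℤ) (N : ℕ) {r : ℤ} (hr : Odd r) (hgood : ¬ APSquareClass (q * r.natAbs) (4 * d)) :
    ‖∑ s ∈ sFiber N r, ((kubotaEps u₀ v r s : ℤ) : ℂ) * heckePsi d χ k ⟨r, s⟩ *
        ((J(s | r.natAbs) * J(r + ω * s | q) : ℤ) : ℂ)‖ ≤
      (4 * d : ℕ) * (Real.sqrt (q * r.natAbs : ℕ) * (1 + Real.log (q * r.natAbs : ℕ)) *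
        (3 + Real.pi * |(k : ℝ)|)) := by
  have hr0 : r ≠ 0 := by rintro rfl; simp at hr
  haveI : NeZero d := ⟨by omega⟩
  haveI : NeZero (4 * d) := ⟨by omega⟩
  have hD : 0 < 4 * d := by omega
  have hD' : (0 : ℤ) < ((4 * d : ℕ) : ℤ) := by exact_mod_cast hD
  set Q : ℕ := q * r.natAbs with hQ
  have hQodd : Odd Q := hqodd.mul (Int.natAbs_odd.mpr hr)
  -- the translation `s = t + ω r`
  set T : Finset ℤ := (sFiber N r).image (· - ω * r) with hT
  have hshift : ∑ s ∈ sFiber N r, ((kubotaEps u₀ v r s : ℤ) : ℂ) * heckePsi d χ k ⟨r, s⟩ *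
        ((J(s | r.natAbs) * J(r + ω * s | q) : ℤ) : ℂ) =
      ((J(ω | q) : ℤ) : ℂ) * ∑ t ∈ T, ((J(t | Q) : ℤ) : ℂ) *
        (((kubotaEps u₀ v r (t + ω * r) : ℤ) : ℂ) * heckePsi d χ k ⟨r, t + ω * r⟩) := by
    rw [sum_shift (sFiber N r) (ω * r), mul_sum]
    refine sum_congr rfl fun t _ => ?_
    rw [jacobiSym_shift hω hr0 hq0 t, hQ, mul_comm q]
    push_cast; ring
  rw [hshift, norm_mul]
  have hJω : ‖((J(ω | q) : ℤ) : ℂ)‖ ≤ 1 := norm_intCast_jacobiSym_le_one _ _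
  -- bound for the `t`-sum by classes modulo `4d`
  have hclasses : ‖∑ t ∈ T, ((J(t | Q) : ℤ) : ℂ) *
        (((kubotaEps u₀ v r (t + ω * r) : ℤ) : ℂ) * heckePsi d χ k ⟨r, t + ω * r⟩)‖ ≤
      (4 * d : ℕ) * (Real.sqrt Q * (1 + Real.log Q) * (3 + Real.pi * |(k : ℝ)|)) := by
    refine norm_sum_le_sum_classes T hD _ fun b hb => ?_
    set c : ℤ := b + ω * r with hc
    set U := apPreimage T b (4 * d : ℕ) with hU
    -- `U` is an interval
    have hUint : IsZInterval U := by
      intro x hx y hy z hxz hzy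
      rw [hU, mem_apPreimage hD'.ne', hT, mem_image] at hx hy ⊢
      obtain ⟨sx, hsx, hx⟩ := hx
      obtain ⟨sy, hsy, hy⟩ := hy
      rw [mem_sFiber] at hsx hsy
      refine ⟨b + (4 * d : ℕ) * z + ω * r, ?_, by ring⟩
      rw [mem_sFiber]
      have hsx' : sx = b + (4 * d : ℕ) * x + ω * r := by linarith
      have hsy' : sy = b + (4 * d : ℕ) * y + ω * r := by linarith
      subst hsx' hsy'
      obtain ⟨⟨hx1, hx2⟩, -, hx4, hx5⟩ := hsx
      obtain ⟨⟨hy1, hy2⟩, -, hy4, hy5⟩ := hsy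
      have hxz' : b + (4 * d : ℕ) * x + ω * r ≤ b + (4 * d : ℕ) * z + ω * r := by nlinarith
      have hzy' : b + (4 * d : ℕ) * z + ω * r ≤ b + (4 * d : ℕ) * y + ω * r := by nlinarith
      refine ⟨⟨by linarith, by linarith⟩, hr, ?_, ?_⟩
      · have : r + (b + (4 * d : ℕ) * z + ω * r) - 1 = (r + (b + (4 * d : ℕ) * x + ω * r) - 1) +
            4 * ((d : ℤ) * (z - x)) := by push_cast; ring
        rw [this]; exact dvd_add hx4 (dvd_mul_right 4 _)
      · have := sq_le_of_between hxz' hzy' (M := (N : ℤ) - r ^ 2) (by linarith) (by linarith)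
        linarith
    -- the class sum in closed form
    have hform : ∑ u ∈ U, ((J(b + (4 * d : ℕ) * u | Q) : ℤ) : ℂ) *
          (((kubotaEps u₀ v r (b + (4 * d : ℕ) * u + ω * r) : ℤ) : ℂ) *
            heckePsi d χ k ⟨r, b + (4 * d : ℕ) * u + ω * r⟩) =
        χ (toQuot (4 * d) ⟨r, c⟩) * ∑ u ∈ U, ((J(b + (4 * d : ℕ) * u | Q) : ℤ) : ℂ) *
          (((kubotaEps u₀ v r (c + (4 * d : ℕ) * u) : ℤ) : ℂ) * ang k ⟨r, c + (4 * d : ℕ) * u⟩) := by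
      rw [mul_sum]
      refine sum_congr rfl fun u _ => ?_
      have hcu : b + (4 * d : ℕ) * u + ω * r = c + (4 * d : ℕ) * u := by rw [hc]; ring
      rw [hcu, heckePsi_eq_mul_ang, toQuot_mk_add_mul]
      ring
    rw [hform, norm_mul]
    have hχ : ‖χ (toQuot (4 * d) ⟨r, c⟩)‖ ≤ 1 := norm_mulChar_apply_le_one χ _
    have hcl := norm_class_sum_le hQodd hD hgood u₀ v hr0 k b c hUint
    calc ‖χ (toQuot (4 * d) ⟨r, c⟩)‖ * _ ≤ 1 * (Real.sqrt Q * (1 + Real.log Q) * (3 + Real.pi * |(k : ℝ)|)) :=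
          mul_le_mul hχ hcl (norm_nonneg _) zero_le_one
      _ = _ := one_mul _
  have h0 : 0 ≤ (4 * d : ℕ) * (Real.sqrt Q * (1 + Real.log Q) * (3 + Real.pi * |(k : ℝ)|)) := by
    have : 0 ≤ Real.log (Q : ℝ) := by
      rcases Nat.eq_zero_or_pos Q with h | h
      · rw [h]; simp
      · exact Real.log_nonneg (by exact_mod_cast h)
    positivity
  calc ‖((J(ω | q) : ℤ) : ℂ)‖ * _ ≤ 1 * ((4 * d : ℕ) * (Real.sqrt Q * (1 + Real.log Q) * (3 + Real.pi * |(k : ℝ)|))) :=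
        mul_le_mul hJω hclasses (norm_nonneg _) zero_le_one
    _ = _ := one_mul _

/-- **The inner sum, trivially**: `≤ #I(r) ≤ 2√N + 1`. [cite: FriedlanderIwaniecAnnals1998, §22 (proof of (22.3))] -/
private theorem norm_inner_le_triv (q : ℕ) (ω : ℤ) {d : ℕ} (hd : 1 ≤ d) (χ : MulChar (GaussQuot (4 * d)) ℂ)
    (k : ℤ) (u₀ v : ℤ) (N : ℕ) (r : ℤ) :
    ‖∑ s ∈ sFiber N r, ((kubotaEps u₀ v r s : ℤ) : ℂ) * heckePsi d χ k ⟨r, s⟩ *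
        ((J(s | r.natAbs) * J(r + ω * s | q) : ℤ) : ℂ)‖ ≤ 2 * Nat.sqrt N + 1 := by
  haveI : NeZero d := ⟨by omega⟩
  calc _ ≤ ∑ s ∈ sFiber N r, ‖((kubotaEps u₀ v r s : ℤ) : ℂ) * heckePsi d χ k ⟨r, s⟩ *
        ((J(s | r.natAbs) * J(r + ω * s | q) : ℤ) : ℂ)‖ := norm_sum_le _ _
    _ ≤ ∑ s ∈ sFiber N r, (1 : ℝ) := by
        refine sum_le_sum fun s _ => ?_
        rw [norm_mul, norm_mul, Int.cast_mul, norm_mul, Complex.norm_intCast]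
        have h1 : |((kubotaEps u₀ v r s : ℤ) : ℝ)| = 1 := by exact_mod_cast abs_kubotaEps u₀ v r s
        have h2 := norm_heckePsi_le_one d χ k ⟨r, s⟩
        have h3 := norm_intCast_jacobiSym_le_one s r.natAbs
        have h4 := norm_intCast_jacobiSym_le_one (r + ω * s) q
        rw [h1, one_mul]
        calc ‖heckePsi d χ k ⟨r, s⟩‖ * (‖((J(s | r.natAbs) : ℤ) : ℂ)‖ * ‖((J(r + ω * s | q) : ℤ) : ℂ)‖)
            ≤ 1 * (1 * 1) := mul_le_mul h2 (mul_le_mul h3 h4 (norm_nonneg _) zero_le_one)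
              (by positivity) zero_le_one
          _ = 1 := by ring
    _ = (sFiber N r).card := by simp
    _ ≤ 2 * Nat.sqrt N + 1 := by exact_mod_cast card_sFiber_le N r

/-! ### Real-variable bookkeeping for the final count -/

/-- `√N · √(√N) = N^{3/4}`. [folklore] -/
private theorem sqrt_mul_sqrt_sqrt_eq_rpow {x : ℝ} (hx : 0 < x) :
    Real.sqrt x * Real.sqrt (Real.sqrt x) = x ^ (3 / 4 : ℝ) := by
  rw [Real.sqrt_eq_rpow, Real.sqrt_eq_rpow, ← Real.rpow_mul hx.le, ← Real.rpow_add hx]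
  norm_num

/-- `⌊√N⌋ · √⌊√N⌋ ≤ N^{3/4}`. [folklore] -/
private theorem natSqrt_mul_sqrt_le {N : ℕ} (hN : 0 < N) :
    (Nat.sqrt N : ℝ) * Real.sqrt (Nat.sqrt N) ≤ (N : ℝ) ^ (3 / 4 : ℝ) := by
  have h1 : (Nat.sqrt N : ℝ) ≤ Real.sqrt N := Real.nat_sqrt_le_real_sqrt
  have h2 : Real.sqrt (Nat.sqrt N : ℝ) ≤ Real.sqrt (Real.sqrt N) := Real.sqrt_le_sqrt h1
  rw [← sqrt_mul_sqrt_sqrt_eq_rpow (by exact_mod_cast hN : (0 : ℝ) < N)]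
  exact mul_le_mul h1 h2 (Real.sqrt_nonneg _) (Real.sqrt_nonneg _)

/-! ### Proposition 22.1 (disc form): the count of degenerate `r`, the numerics, the assembly -/

/-- The odd `r ∈ [-R, R]` with `q|r|` degenerate number at most `2 τ(4d) ⌊√(qR)⌋`. [folklore] -/
private theorem card_bad_le (q d N : ℕ) (hq : 0 < q) (hd : 1 ≤ d)
    [DecidablePred fun r : ℤ => Odd r ∧ APSquareClass (q * r.natAbs) (4 * d)] :
    ((rRange N).filter fun r : ℤ => Odd r ∧ APSquareClass (q * r.natAbs) (4 * d)).card ≤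
      2 * ((4 * d).divisors.card * Nat.sqrt (q * Nat.sqrt N)) := by
  classical
  set R := Nat.sqrt N with hR
  set bad : Finset ℤ := (rRange N).filter fun r : ℤ => Odd r ∧ APSquareClass (q * r.natAbs) (4 * d)
    with hbad
  have himage : bad.image Int.natAbs ⊆ (Icc 1 R).filter fun r' => APSquareClass (q * r') (4 * d) := by
    intro a ha
    rw [mem_image] at ha
    obtain ⟨r, hr, rfl⟩ := ha
    rw [hbad, mem_filter, rRange, mem_Icc] at hr
    obtain ⟨⟨h1, h2⟩, hro, hsq⟩ := hr
    rw [mem_filter, mem_Icc]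
    refine ⟨⟨Int.natAbs_pos.mpr (by rintro rfl; simp at hro), ?_⟩, hsq⟩
    have : (r.natAbs : ℤ) ≤ R := by rw [Int.natCast_natAbs]; exact abs_le.mpr ⟨h1, h2⟩
    exact_mod_cast this
  have hfib : ∀ a ∈ bad.image Int.natAbs, (bad.filter fun r => r.natAbs = a).card ≤ 2 := by
    intro a _
    calc (bad.filter fun r => r.natAbs = a).card ≤ ({(a : ℤ), -(a : ℤ)} : Finset ℤ).card := by
          refine card_le_card fun r hr => ?_
          rw [mem_filter] at hr
          rw [mem_insert, mem_singleton]
          rcases Int.natAbs_eq r with h | h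
          · left; rw [h, hr.2]
          · right; rw [h, hr.2]
      _ ≤ 2 := card_le_two
  calc bad.card ≤ 2 * (bad.image Int.natAbs).card := card_le_mul_card_image _ 2 hfib
    _ ≤ 2 * ((Icc 1 R).filter fun r' => APSquareClass (q * r') (4 * d)).card :=
        Nat.mul_le_mul_left 2 (card_le_card himage)
    _ ≤ 2 * ((4 * d).divisors.card * Nat.sqrt (q * R)) :=
        Nat.mul_le_mul_left 2 (card_filter_apSquareClass_mul_le hq (by omega) R)

/-- The numerical bookkeeping of the final count: with `R = ⌊√N⌋`,
`(2R+1) · 4d √(qR)(1+log(qR))(3+π|k|) + (2R+1) · 2 · 4d · √(qR) ≤ 250 d(|k|+1) √q N^{3/4} log(√q N)`.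
[folklore] -/
private theorem final_numerics {q d N : ℕ} (hq : 1 ≤ q) (hd : 1 ≤ d) (hN : 2 ≤ N) (k : ℤ) :
    (2 * (Nat.sqrt N : ℝ) + 1) * ((4 * d : ℕ) * (Real.sqrt (q * Nat.sqrt N : ℕ) *
        (1 + Real.log (q * Nat.sqrt N : ℕ)) * (3 + Real.pi * |(k : ℝ)|))) +
      (2 * (Nat.sqrt N : ℝ) + 1) * (2 * ((4 * d : ℕ) * Real.sqrt (q * Nat.sqrt N : ℕ))) ≤
      250 * (d * (|k| + 1 : ℝ)) * Real.sqrt q * (N : ℝ) ^ (3 / 4 : ℝ) * Real.log (Real.sqrt q * N) := by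
  set R : ℕ := Nat.sqrt N with hR
  set S : ℝ := Real.sqrt q with hS
  have hS1 : 1 ≤ S := by rw [hS, ← Real.sqrt_one]; exact Real.sqrt_le_sqrt (by exact_mod_cast hq)
  have hN1 : (1 : ℝ) ≤ N := by exact_mod_cast (by omega : 1 ≤ N)
  have hN2 : (2 : ℝ) ≤ N := by exact_mod_cast hN
  set L : ℝ := Real.log (S * N) with hL
  have hL2 : Real.log 2 ≤ L := Real.log_le_log (by norm_num) (by nlinarith)
  have hLhalf : 1 ≤ 2 * L := by linarith [Real.log_two_gt_d9]
  have hL0 : 0 < L := by linarith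
  set X : ℝ := (N : ℝ) ^ (3 / 4 : ℝ) with hX
  have hX0 : 0 < X := Real.rpow_pos_of_pos (by linarith) _
  have hR1 : 1 ≤ R := by rw [hR, Nat.le_sqrt]; omega
  have hRle : (R : ℝ) ≤ Real.sqrt N := Real.nat_sqrt_le_real_sqrt
  have hR1' : (1 : ℝ) ≤ R := by exact_mod_cast hR1
  have hRX : (R : ℝ) * Real.sqrt R ≤ X := natSqrt_mul_sqrt_le (by omega)
  have hsqrtqR : Real.sqrt ((q * R : ℕ) : ℝ) = S * Real.sqrt R := by
    push_cast; rw [Real.sqrt_mul (by positivity), hS]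
  have h2R1 : (2 * (R : ℝ) + 1) ≤ 3 * R := by linarith
  -- `(2R+1) √(qR) ≤ 3 S X`
  have hA : (2 * (R : ℝ) + 1) * Real.sqrt ((q * R : ℕ) : ℝ) ≤ 3 * S * X := by
    rw [hsqrtqR]
    calc (2 * (R : ℝ) + 1) * (S * Real.sqrt R) ≤ 3 * R * (S * Real.sqrt R) :=
          mul_le_mul_of_nonneg_right h2R1 (by positivity)
      _ = 3 * S * (R * Real.sqrt R) := by ring
      _ ≤ 3 * S * X := mul_le_mul_of_nonneg_left hRX (by positivity)
  -- `1 + log(qR) ≤ 4 L`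
  have hsqrtN : Real.sqrt (N : ℝ) ≤ N := by
    calc Real.sqrt (N : ℝ) ≤ Real.sqrt ((N : ℝ) ^ 2) := Real.sqrt_le_sqrt (by nlinarith)
      _ = N := Real.sqrt_sq (by linarith)
  have hB : 1 + Real.log ((q * R : ℕ) : ℝ) ≤ 4 * L := by
    have hqR : ((q * R : ℕ) : ℝ) ≤ (S * N) ^ 2 := by
      push_cast
      have hSS : S ^ 2 = q := by rw [hS, Real.sq_sqrt (by positivity)]
      calc (q : ℝ) * R ≤ q * Real.sqrt N := mul_le_mul_of_nonneg_left hRle (by positivity)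
        _ ≤ q * N := mul_le_mul_of_nonneg_left hsqrtN (by positivity)
        _ ≤ q * N ^ 2 := by
            refine mul_le_mul_of_nonneg_left ?_ (by positivity); nlinarith
        _ = (S * N) ^ 2 := by rw [mul_pow, hSS]
    have hlog : Real.log ((q * R : ℕ) : ℝ) ≤ 2 * L := by
      have hpos : (0 : ℝ) < ((q * R : ℕ) : ℝ) := by exact_mod_cast Nat.mul_pos (by omega) (by omega)
      calc Real.log ((q * R : ℕ) : ℝ) ≤ Real.log ((S * N) ^ 2) := Real.log_le_log hpos hqR
        _ = 2 * L := by rw [Real.log_pow]; push_cast; rw [hL]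
    linarith
  have hlog0 : 0 ≤ 1 + Real.log ((q * R : ℕ) : ℝ) := by
    have : 0 ≤ Real.log ((q * R : ℕ) : ℝ) :=
      Real.log_nonneg (by exact_mod_cast Nat.mul_pos (by omega) (by omega))
    linarith
  -- `3 + π|k| ≤ 4(|k|+1)`
  have hC : 3 + Real.pi * |(k : ℝ)| ≤ 4 * (|k| + 1 : ℝ) := by
    have := Real.pi_le_four
    have hk0 : 0 ≤ |(k : ℝ)| := abs_nonneg _
    push_cast
    nlinarith
  have hd' : ((4 * d : ℕ) : ℝ) = 4 * d := by push_cast; ring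
  rw [hd']
  have hk1 : (1 : ℝ) ≤ (|k| + 1 : ℝ) := by simp
  -- the good part
  have hgood : (2 * (R : ℝ) + 1) * (4 * d * (Real.sqrt ((q * R : ℕ) : ℝ) *
      (1 + Real.log ((q * R : ℕ) : ℝ)) * (3 + Real.pi * |(k : ℝ)|))) ≤ 192 * (d * (|k| + 1 : ℝ)) * S * X * L := by
    calc (2 * (R : ℝ) + 1) * (4 * d * (Real.sqrt ((q * R : ℕ) : ℝ) * (1 + Real.log ((q * R : ℕ) : ℝ)) *
          (3 + Real.pi * |(k : ℝ)|)))
        = 4 * d * (((2 * (R : ℝ) + 1) * Real.sqrt ((q * R : ℕ) : ℝ)) * (1 + Real.log ((q * R : ℕ) : ℝ)) *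
          (3 + Real.pi * |(k : ℝ)|)) := by ring
      _ ≤ 4 * d * ((3 * S * X) * (4 * L) * (4 * (|k| + 1 : ℝ))) := by
          refine mul_le_mul_of_nonneg_left ?_ (by positivity)
          exact mul_le_mul (mul_le_mul hA hB hlog0 (by positivity)) hC (by positivity) (by positivity)
      _ = 192 * (d * (|k| + 1 : ℝ)) * S * X * L := by ring
  -- the bad part
  have hbad : (2 * (R : ℝ) + 1) * (2 * (4 * d * Real.sqrt ((q * R : ℕ) : ℝ))) ≤
      48 * (d * (|k| + 1 : ℝ)) * S * X * L := by
    calc (2 * (R : ℝ) + 1) * (2 * (4 * d * Real.sqrt ((q * R : ℕ) : ℝ)))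
        = 8 * d * ((2 * (R : ℝ) + 1) * Real.sqrt ((q * R : ℕ) : ℝ)) := by ring
      _ ≤ 8 * d * (3 * S * X) := mul_le_mul_of_nonneg_left hA (by positivity)
      _ = 24 * d * S * X * 1 * 1 := by ring
      _ ≤ 24 * d * S * X * (|k| + 1 : ℝ) * (2 * L) :=
          mul_le_mul (mul_le_mul_of_nonneg_left hk1 (by positivity)) hLhalf zero_le_one (by positivity)
      _ = 48 * (d * (|k| + 1 : ℝ)) * S * X * L := by ring
  have h0 : 0 ≤ (d * (|k| + 1 : ℝ)) * S * X * L := by positivity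
  linarith

/-- **Friedlander–Iwaniec, Proposition 22.1, (22.3), for the disc.** There is an absolute constant
`C` such that for every `d ≥ 1`, every character `χ` of `ℤ[i]/(4d)`, every `k ∈ ℤ` (Hecke character
`ψ(z) = χ(z)(z/|z|)^k`, (17.17)), every primary `w` and every `N ≥ 2`,
`‖Σ_{z primary, 1 ≤ |z|² ≤ N} ψ(z) [wz]‖ ≤ C · d(|k|+1) · |w| · N^{3/4} · log(|w| N)`
(`|w| = √(w w̄)`). The source states (22.3) for `z` in a polar box `𝔅` inside the disc and `w`
primary; this is the case `𝔅 =` the whole disc, which is what Proposition 23.2 and Theorem 2^ψ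
use. [cite: FriedlanderIwaniecAnnals1998, Proposition 22.1 (22.3)] -/
theorem norm_linearFormK_le :
    ∃ C : ℝ, 0 < C ∧ ∀ d : ℕ, 1 ≤ d → ∀ χ : MulChar (GaussQuot (4 * d)) ℂ, ∀ k : ℤ,
      ∀ w : GaussianInt, IsPrimary w → ∀ N : ℕ, 2 ≤ N →
        ‖∑ z ∈ primaryNormLE N, heckePsi d χ k z * jacobiKubota (w * z)‖ ≤
          C * (d * (|k| + 1 : ℝ)) * Real.sqrt (w.norm : ℝ) * (N : ℝ) ^ (3 / 4 : ℝ) *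
            Real.log (Real.sqrt (w.norm : ℝ) * N) := by
  refine ⟨250, by norm_num, fun d hd χ k w hw N hN => ?_⟩
  classical
  haveI : NeZero d := ⟨by omega⟩
  -- basic quantities
  set q : ℕ := w.norm.natAbs with hq
  have hnormpos : 0 < w.norm := GaussianInt.norm_pos.mpr hw.ne_zero
  have hqZ : (q : ℤ) = w.norm := by rw [hq]; exact Int.natAbs_of_nonneg hnormpos.le
  have hq1 : 1 ≤ q := by
    have : (1 : ℤ) ≤ q := by rw [hqZ]; omega
    exact_mod_cast this
  have hq0 : q ≠ 0 := by omega
  have hqodd : Odd q := odd_natAbs_norm_of_isPrimary hw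
  have hwnorm : (w.norm : ℝ) = q := by exact_mod_cast hqZ.symm
  rw [hwnorm]
  have hRHS0 : 0 ≤ 250 * (d * (|k| + 1 : ℝ)) * Real.sqrt q * (N : ℝ) ^ (3 / 4 : ℝ) *
      Real.log (Real.sqrt q * N) := by
    have hS1 : 1 ≤ Real.sqrt q := by
      rw [← Real.sqrt_one]; exact Real.sqrt_le_sqrt (by exact_mod_cast hq1)
    have hN2 : (2 : ℝ) ≤ N := by exact_mod_cast hN
    have : 0 ≤ Real.log (Real.sqrt q * N) := Real.log_nonneg (by nlinarith)
    positivity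
  -- if `w` is not primitive every term vanishes
  by_cases hprim : IsPrimitive w
  swap
  · have h0 : ∑ z ∈ primaryNormLE N, heckePsi d χ k z * jacobiKubota (w * z) = 0 := by
      refine sum_eq_zero fun z hz => ?_
      rw [mem_primaryNormLE] at hz
      rw [jacobiKubota_mul_eq_zero_of_not_isPrimitive hw hprim hz.1, mul_zero]
    rw [h0, norm_zero]; exact hRHS0
  -- `w` primary primitive: the root `ω`
  obtain ⟨ω, hωq, hω⟩ := exists_int_dirichletSym_eq hw hprim
  set R : ℕ := Nat.sqrt N with hR
  have hRR : ((rRange N).card : ℝ) = 2 * (R : ℝ) + 1 := by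
    rw [rRange, Int.card_Icc]
    have : ((Nat.sqrt N : ℤ) + 1 - -(Nat.sqrt N : ℤ)) = ((2 * Nat.sqrt N + 1 : ℕ) : ℤ) := by push_cast; ring
    rw [this, Int.toNat_natCast]; push_cast; rw [hR]
  -- the inner sums
  set inner : ℤ → ℂ := fun r => ∑ s ∈ sFiber N r, ((kubotaEps w.re w.im r s : ℤ) : ℂ) *
    heckePsi d χ k ⟨r, s⟩ * ((J(s | r.natAbs) * J(r + ω * s | q) : ℤ) : ℂ) with hinner
  have hr_eq : ∀ r : ℤ, ∑ s ∈ sFiber N r, heckePsi d χ k ⟨r, s⟩ * jacobiKubota (w * ⟨r, s⟩) =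
      jacobiKubota w * Complex.I ^ ((r - 1) / 2) * inner r := by
    intro r
    rw [hinner, mul_sum]
    refine sum_congr rfl fun s hs => ?_
    rw [mem_sFiber] at hs
    obtain ⟨-, hro, h4, -⟩ := hs
    have hse : Even s := by
      obtain ⟨m, hm⟩ := hro
      obtain ⟨c, hc⟩ := h4
      exact Int.even_iff.mpr (by omega)
    rw [term_eq hw hprim hω d χ k hro hse]
  -- bounds for the inner sums
  set gB : ℝ := (4 * d : ℕ) * (Real.sqrt (q * R : ℕ) * (1 + Real.log (q * R : ℕ)) *
    (3 + Real.pi * |(k : ℝ)|)) with hgB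
  have hgB0 : 0 ≤ gB := by
    have : 0 ≤ Real.log ((q * R : ℕ) : ℝ) := by
      rcases Nat.eq_zero_or_pos (q * R) with h | h
      · rw [h]; simp
      · exact Real.log_nonneg (by exact_mod_cast h)
    positivity
  have hinner_le : ∀ r ∈ rRange N, ‖inner r‖ ≤
      gB + (if Odd r ∧ APSquareClass (q * r.natAbs) (4 * d) then 2 * (R : ℝ) + 1 else 0) := by
    intro r hr
    rw [rRange, mem_Icc] at hr
    by_cases hro : Odd r
    · by_cases hgood : APSquareClass (q * r.natAbs) (4 * d)
      · rw [if_pos ⟨hro, hgood⟩]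
        have h := norm_inner_le_triv q ω hd χ k w.re w.im N r
        have : ‖inner r‖ ≤ 2 * (R : ℝ) + 1 := by rw [hR]; exact h
        linarith
      · have h := norm_inner_le_good hq0 hqodd hωq hd χ k w.re w.im N hro hgood
        have hrabs : r.natAbs ≤ R := by
          have : (r.natAbs : ℤ) ≤ R := by rw [Int.natCast_natAbs]; exact abs_le.mpr ⟨hr.1, hr.2⟩
          exact_mod_cast this
        have hr1 : 1 ≤ r.natAbs := Int.natAbs_pos.mpr (by rintro rfl; simp at hro)
        have hle1 : ((q * r.natAbs : ℕ) : ℝ) ≤ ((q * R : ℕ) : ℝ) := by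
          exact_mod_cast Nat.mul_le_mul_left q hrabs
        have hpos1 : (0 : ℝ) < ((q * r.natAbs : ℕ) : ℝ) := by
          exact_mod_cast Nat.mul_pos (by omega) hr1
        have hl0 : 0 ≤ Real.log ((q * r.natAbs : ℕ) : ℝ) :=
          Real.log_nonneg (by exact_mod_cast Nat.mul_pos (by omega) hr1)
        have hmono : Real.sqrt ((q * r.natAbs : ℕ) : ℝ) * (1 + Real.log ((q * r.natAbs : ℕ) : ℝ)) ≤
            Real.sqrt ((q * R : ℕ) : ℝ) * (1 + Real.log ((q * R : ℕ) : ℝ)) :=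
          mul_le_mul (Real.sqrt_le_sqrt hle1) (by linarith [Real.log_le_log hpos1 hle1])
            (by linarith) (Real.sqrt_nonneg _)
        have : ‖inner r‖ ≤ gB := by
          refine h.trans ?_
          rw [hgB]
          exact mul_le_mul_of_nonneg_left (mul_le_mul_of_nonneg_right hmono (by positivity)) (by positivity)
        rw [if_neg (fun h => hgood h.2)]
        linarith
    · have hempty : sFiber N r = ∅ := by
        rw [sFiber, filter_eq_empty_iff]; intro s _ h; exact hro h.1
      have : inner r = 0 := by rw [hinner]; simp only [hempty, sum_empty]
      rw [this, norm_zero, if_neg (fun h => hro h.1), add_zero]; exact hgB0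
  -- the number of bad `r`
  have hbad_card : (((rRange N).filter fun r => Odd r ∧ APSquareClass (q * r.natAbs) (4 * d)).card : ℝ) ≤
      2 * ((4 * d : ℕ) * Real.sqrt (q * R : ℕ)) := by
    have h3 := card_bad_le q d N (by omega) hd
    have h4 : (Nat.sqrt (q * R) : ℝ) ≤ Real.sqrt (q * R : ℕ) := Real.nat_sqrt_le_real_sqrt
    have h5 : ((4 * d).divisors.card : ℝ) ≤ (4 * d : ℕ) := by exact_mod_cast Nat.card_divisors_le_self _
    calc (((rRange N).filter fun r => Odd r ∧ APSquareClass (q * r.natAbs) (4 * d)).card : ℝ)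
        ≤ 2 * (((4 * d).divisors.card : ℝ) * (Nat.sqrt (q * R) : ℝ)) := by exact_mod_cast h3
      _ ≤ 2 * ((4 * d : ℕ) * Real.sqrt (q * R : ℕ)) := by gcongr
  -- summing over `r`
  rw [sum_primaryNormLE_eq]
  calc ‖∑ r ∈ rRange N, ∑ s ∈ sFiber N r, heckePsi d χ k ⟨r, s⟩ * jacobiKubota (w * ⟨r, s⟩)‖
      ≤ ∑ r ∈ rRange N, ‖∑ s ∈ sFiber N r, heckePsi d χ k ⟨r, s⟩ * jacobiKubota (w * ⟨r, s⟩)‖ :=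
        norm_sum_le _ _
    _ ≤ ∑ r ∈ rRange N, ‖inner r‖ := by
        refine sum_le_sum fun r _ => ?_
        rw [hr_eq, norm_mul, norm_mul, norm_I_zpow, mul_one]
        calc ‖jacobiKubota w‖ * ‖inner r‖ ≤ 1 * ‖inner r‖ :=
              mul_le_mul_of_nonneg_right (norm_jacobiKubota_le_one w) (norm_nonneg _)
          _ = ‖inner r‖ := one_mul _
    _ ≤ ∑ r ∈ rRange N, (gB + if Odd r ∧ APSquareClass (q * r.natAbs) (4 * d) then 2 * (R : ℝ) + 1 else 0) :=
        sum_le_sum hinner_le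
    _ = (rRange N).card * gB +
          (2 * (R : ℝ) + 1) * ((rRange N).filter fun r => Odd r ∧ APSquareClass (q * r.natAbs) (4 * d)).card := by
        rw [sum_add_distrib, sum_const, nsmul_eq_mul, ← sum_filter, sum_const, nsmul_eq_mul, mul_comm (2 * (R : ℝ) + 1)]
    _ ≤ (2 * (R : ℝ) + 1) * gB + (2 * (R : ℝ) + 1) * (2 * ((4 * d : ℕ) * Real.sqrt (q * R : ℕ))) := by
        rw [hRR]
        exact add_le_add le_rfl (mul_le_mul_of_nonneg_left hbad_card (by positivity))
    _ ≤ 250 * (d * (|k| + 1 : ℝ)) * Real.sqrt q * (N : ℝ) ^ (3 / 4 : ℝ) * Real.log (Real.sqrt q * N) := by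
        rw [hgB, hR]; exact final_numerics hq1 hd hN k

end Literature.NumberTheory.Sieve.FriedlanderIwaniecPrimes
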